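import Literature.NumberTheory.Sieve.BombieriFriedlanderIwaniecTheorem7StarBlocks
import Literature.NumberTheory.Sieve.BombieriFriedlanderIwaniecTheorem5Weights
import Literature.NumberTheory.Sieve.DivisorBound
import HarnessLib

/-!
# Bombieri–Friedlander–Iwaniec 1986, Theorem 7 (§14) — step 1: the triple sum with weights and its smoothing

Topic `Literature/NumberTheory/Sieve`.  First file of the formalisation of the CORE of the proof of
Theorem 7 of E. Bombieri, J. B. Friedlander, H. Iwaniec, *Primes in arithmetic progressions to large
moduli*, Acta Math. 156 (1986), 203–251, §14 (pp. 244–246), i.e. of the bound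
`Δ(M, N, L, Q, R) ≪ x^{1−ε}` ((14.1)) in the regime (14.4)–(14.6), for the sum
`Δ = ∑_{r∼R,(r,a)=1} ∑_{l∼L,(l,r)=1} |∑_{q∼Q,(q,al)=1} (∑_{m∼M,n∼N, lmn≡a (qr)} 1
 − φ(qr)⁻¹ ∑_{(mn,qr)=1} 1)|` (the `z ≤ 2` case of the tree's `BFI.deltaStarSets` on dyadic ranges).
It parallels step 1 of the tree's Theorem 5 pipeline (`…Theorem5Weights`): BFI, p. 244, work with
"`Δ₀(M, N, L, Q, R)`", the sum `Δ` with the sharp range of `m` replaced by the smooth weight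
`α(m)` of (A₆') (p. 235), at the cost of an admissible error; for the application of Lemma 1 with
`c = n` and `d = q` (p. 245) the ranges of `n` and `q` have to carry smooth weights as well.
Everything here is PROVED; no named fact is introduced.

## Contents

* `BFI.congrW`, `BFI.coprW`, `BFI.bracketT`, `BFI.qSumT`, **`BFI.tripleT a Xm Xn Xq α β γ L R`** —
  the sum `Δ` of §14 with real weights `α(m)`, `β(n)`, `γ(q)` on `m ≤ Xm`, `n ≤ Xn`, `q ≤ Xq`
  (and `r ∼ R`, `l ∼ L` sharp, with the coprimality conditions `(r,a) = 1`, `(l,r) = 1`,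
  `(q, al) = 1` of p. 244); `BFI.ind S` (indicator weight);
  `BFI.deltaStarSets_eq_tripleT` (`z ≤ 2`, sets inside the cut-offs).
* Linearity in each weight (`congrW_sub_left`, …, `qSumT_sub_gamma`) and **subadditivity**
  `BFI.tripleT_sub_le_alpha/beta/gamma` (`Δ(α₁ − α₂) ≤ Δ(α₁) + Δ(α₂)`), `BFI.tripleT_swap`
  (`m ↔ n`).
* Trivial bounds: `BFI.tripleT_le_sum_abs` (dropping the filters),
  `BFI.sum_triple_dvd_indicator_le` (`#{(l,m,n) : lmn ≡ a (d)} ≪ X^δ (2LXmXn/d + 1)` through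
  `k = lmn`, `τ(k)²` triples per `k`), `BFI.card_Icc_filter_natCast_eq_le`,
  **`BFI.tripleT_le_of_thin_alpha`** (a weight `α` supported on a set `T` of integers `> a`:
  `Δ ≤ C_δ X^δ · #T (2L + 1) Xn` — the mechanism of BFI's (12.1)/(14.3), via
  `#{(q, r) : qr ∣ lmn − a} ≤ τ(lmn − a)²`),
  **`BFI.tripleT_le_of_thin_gamma`** (a weight `γ` supported on `T ⊆ [Q₀, ∞)`:
  `Δ ≤ C_δ X^δ (#T/Q₀ · (2L + 1) Xm Xn + #T (2R + 1))`).
* `BFI.tripleT_indicator_le_split` — `Δ(1_M, 1_N, 1_Q) ≤ Δ(α, β, γ) + Δ(α − 1_M, 1_N, 1_Q)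
  + Δ(α, β − 1_N, 1_Q) + Δ(α, β, γ − 1_Q)` for any weights, and
  **`BFI.tripleT_indicator_le_smooth`** — the smoothing step quantified: with
  `α = BFI.bumpW M Y_M`, `β = BFI.bumpW N Y_N`, `γ = BFI.bumpW Q Y_Q` (the weight `BFI.bump` of the
  tree's `…Theorem5Weights`, `= 1` on the dyadic range, transitions of length `Y`), the three
  corrections are supported on the transition sets `BFI.bumpDiffSupport` (`≤ 2Y + 2` integers) and
  cost `≤ C_δ X^δ ((2Y_M+2)(2L+1)Xn + (2Y_N+2)(2L+1)Xm + (2Y_Q+2)(2/Q)(2L+1)XmXn + (2Y_Q+2)(2R+1))`.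

## References

* E. Bombieri, J. B. Friedlander, H. Iwaniec, Acta Math. 156 (1986), 203–251: §12 (A₆'), (12.1)
  p. 235; §14 (14.1)–(14.3) pp. 244–245. [BombieriFriedlanderIwaniecActa1986]
-/

noncomputable section

open Finset Real
open scoped ArithmeticFunction.sigma

namespace Literature.NumberTheory.Sieve

namespace BFI

/-! ### The triple sum of §14 with weights -/

/-- The weighted congruence count `∑_{m ≤ Xm} ∑_{n ≤ Xn} α(m) β(n) 1_{lmn ≡ a (mod d)}`.
[cite: BombieriFriedlanderIwaniecActa1986, §14 p. 244] -/
def congrW (a : ℤ) (Xm Xn : ℕ) (α β : ℕ → ℝ) (l d : ℕ) : ℝ :=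
  ∑ m ∈ Icc 1 Xm, ∑ n ∈ Icc 1 Xn,
    if ((l * m * n : ℕ) : ZMod d) = (a : ZMod d) then α m * β n else 0

/-- The weighted coprimality count `∑_{m ≤ Xm} ∑_{n ≤ Xn} α(m) β(n) 1_{(mn, d) = 1}`.
[cite: BombieriFriedlanderIwaniecActa1986, §14 p. 244] -/
def coprW (Xm Xn : ℕ) (α β : ℕ → ℝ) (d : ℕ) : ℝ :=
  ∑ m ∈ Icc 1 Xm, ∑ n ∈ Icc 1 Xn, if (m * n).Coprime d then α m * β n else 0

/-- The bracket `count − expected/φ(d)` at one modulus. [cite: BombieriFriedlanderIwaniecActa1986, §14 p. 244] -/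
def bracketT (a : ℤ) (Xm Xn : ℕ) (α β : ℕ → ℝ) (l d : ℕ) : ℝ :=
  congrW a Xm Xn α β l d - coprW Xm Xn α β d / (Nat.totient d : ℝ)

/-- The weighted `q`-sum `∑_{q ≤ Xq, (q, al) = 1} γ(q) · bracket(qr)`. [cite: BombieriFriedlanderIwaniecActa1986, §14 p. 244] -/
def qSumT (a : ℤ) (Xm Xn Xq : ℕ) (α β γ : ℕ → ℝ) (r l : ℕ) : ℝ :=
  ∑ q ∈ (Icc 1 Xq).filter (fun q : ℕ => IsCoprime (q : ℤ) (a * l)),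
    γ q * bracketT a Xm Xn α β l (q * r)

/-- **The sum `Δ` of §14 with weights**:
`∑_{r ∼ R, (r,a)=1} ∑_{l ∼ L, (l,r)=1} |∑_{q ≤ Xq, (q,al)=1} γ(q) (∑ α(m)β(n) 1_{lmn≡a (qr)}
 − φ(qr)⁻¹ ∑ α(m)β(n) 1_{(mn,qr)=1})|`. [cite: BombieriFriedlanderIwaniecActa1986, §14 (14.1) p. 244] -/
def tripleT (a : ℤ) (Xm Xn Xq : ℕ) (α β γ : ℕ → ℝ) (L R : ℝ) : ℝ :=
  ∑ r ∈ (dyadic R).filter (fun r : ℕ => IsCoprime (r : ℤ) a),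
    ∑ l ∈ (dyadic L).filter (fun l : ℕ => l.Coprime r), |qSumT a Xm Xn Xq α β γ r l|

/-- The indicator weight of a finite set. [folklore] -/
def ind (S : Finset ℕ) (m : ℕ) : ℝ := if m ∈ S then 1 else 0

/-- Unfolding of `ind`. [folklore] -/
theorem ind_apply (S : Finset ℕ) (m : ℕ) : ind S m = if m ∈ S then 1 else 0 := rfl

/-- `ind S m = 1` on `S`. [folklore] -/
theorem ind_of_mem {S : Finset ℕ} {m : ℕ} (h : m ∈ S) : ind S m = 1 := if_pos h

/-- `ind S m = 0` off `S`. [folklore] -/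
theorem ind_of_not_mem {S : Finset ℕ} {m : ℕ} (h : m ∉ S) : ind S m = 0 := if_neg h

/-- `|ind S m| ≤ 1`. [folklore] -/
theorem abs_ind_le_one (S : Finset ℕ) (m : ℕ) : |ind S m| ≤ 1 := by
  unfold ind; split_ifs <;> simp

/-- `0 ≤ ind S m`. [folklore] -/
theorem ind_nonneg (S : Finset ℕ) (m : ℕ) : 0 ≤ ind S m := by
  unfold ind; split_ifs <;> simp

/-- `Δ ≥ 0`. [folklore] -/
theorem tripleT_nonneg (a : ℤ) (Xm Xn Xq : ℕ) (α β γ : ℕ → ℝ) (L R : ℝ) :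
    0 ≤ tripleT a Xm Xn Xq α β γ L R :=
  Finset.sum_nonneg fun _ _ => Finset.sum_nonneg fun _ _ => abs_nonneg _

/-! ### Linearity in each weight -/

/-- `congrW` is additive in `α`. [folklore] -/
theorem congrW_sub_left (a : ℤ) (Xm Xn : ℕ) (α₁ α₂ β : ℕ → ℝ) (l d : ℕ) :
    congrW a Xm Xn (α₁ - α₂) β l d = congrW a Xm Xn α₁ β l d - congrW a Xm Xn α₂ β l d := by
  unfold congrW
  rw [← Finset.sum_sub_distrib]
  refine Finset.sum_congr rfl fun m _ => ?_
  rw [← Finset.sum_sub_distrib]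
  refine Finset.sum_congr rfl fun n _ => ?_
  simp only [Pi.sub_apply]
  split_ifs <;> ring

/-- `congrW` is additive in `β`. [folklore] -/
theorem congrW_sub_right (a : ℤ) (Xm Xn : ℕ) (α β₁ β₂ : ℕ → ℝ) (l d : ℕ) :
    congrW a Xm Xn α (β₁ - β₂) l d = congrW a Xm Xn α β₁ l d - congrW a Xm Xn α β₂ l d := by
  unfold congrW
  rw [← Finset.sum_sub_distrib]
  refine Finset.sum_congr rfl fun m _ => ?_
  rw [← Finset.sum_sub_distrib]
  refine Finset.sum_congr rfl fun n _ => ?_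
  simp only [Pi.sub_apply]
  split_ifs <;> ring

/-- `coprW` is additive in `α`. [folklore] -/
theorem coprW_sub_left (Xm Xn : ℕ) (α₁ α₂ β : ℕ → ℝ) (d : ℕ) :
    coprW Xm Xn (α₁ - α₂) β d = coprW Xm Xn α₁ β d - coprW Xm Xn α₂ β d := by
  unfold coprW
  rw [← Finset.sum_sub_distrib]
  refine Finset.sum_congr rfl fun m _ => ?_
  rw [← Finset.sum_sub_distrib]
  refine Finset.sum_congr rfl fun n _ => ?_
  simp only [Pi.sub_apply]
  split_ifs <;> ring

/-- `coprW` is additive in `β`. [folklore] -/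
theorem coprW_sub_right (Xm Xn : ℕ) (α β₁ β₂ : ℕ → ℝ) (d : ℕ) :
    coprW Xm Xn α (β₁ - β₂) d = coprW Xm Xn α β₁ d - coprW Xm Xn α β₂ d := by
  unfold coprW
  rw [← Finset.sum_sub_distrib]
  refine Finset.sum_congr rfl fun m _ => ?_
  rw [← Finset.sum_sub_distrib]
  refine Finset.sum_congr rfl fun n _ => ?_
  simp only [Pi.sub_apply]
  split_ifs <;> ring

/-- The bracket is additive in `α`. [folklore] -/
theorem bracketT_sub_left (a : ℤ) (Xm Xn : ℕ) (α₁ α₂ β : ℕ → ℝ) (l d : ℕ) :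
    bracketT a Xm Xn (α₁ - α₂) β l d = bracketT a Xm Xn α₁ β l d - bracketT a Xm Xn α₂ β l d := by
  unfold bracketT
  rw [congrW_sub_left, coprW_sub_left]
  ring

/-- The bracket is additive in `β`. [folklore] -/
theorem bracketT_sub_right (a : ℤ) (Xm Xn : ℕ) (α β₁ β₂ : ℕ → ℝ) (l d : ℕ) :
    bracketT a Xm Xn α (β₁ - β₂) l d = bracketT a Xm Xn α β₁ l d - bracketT a Xm Xn α β₂ l d := by
  unfold bracketT
  rw [congrW_sub_right, coprW_sub_right]
  ring

/-- The `q`-sum is additive in `α`. [folklore] -/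
theorem qSumT_sub_alpha (a : ℤ) (Xm Xn Xq : ℕ) (α₁ α₂ β γ : ℕ → ℝ) (r l : ℕ) :
    qSumT a Xm Xn Xq (α₁ - α₂) β γ r l = qSumT a Xm Xn Xq α₁ β γ r l - qSumT a Xm Xn Xq α₂ β γ r l := by
  unfold qSumT
  rw [← Finset.sum_sub_distrib]
  refine Finset.sum_congr rfl fun q _ => ?_
  rw [bracketT_sub_left]
  ring

/-- The `q`-sum is additive in `β`. [folklore] -/
theorem qSumT_sub_beta (a : ℤ) (Xm Xn Xq : ℕ) (α β₁ β₂ γ : ℕ → ℝ) (r l : ℕ) :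
    qSumT a Xm Xn Xq α (β₁ - β₂) γ r l = qSumT a Xm Xn Xq α β₁ γ r l - qSumT a Xm Xn Xq α β₂ γ r l := by
  unfold qSumT
  rw [← Finset.sum_sub_distrib]
  refine Finset.sum_congr rfl fun q _ => ?_
  rw [bracketT_sub_right]
  ring

/-- The `q`-sum is additive in `γ`. [folklore] -/
theorem qSumT_sub_gamma (a : ℤ) (Xm Xn Xq : ℕ) (α β γ₁ γ₂ : ℕ → ℝ) (r l : ℕ) :
    qSumT a Xm Xn Xq α β (γ₁ - γ₂) r l = qSumT a Xm Xn Xq α β γ₁ r l - qSumT a Xm Xn Xq α β γ₂ r l := by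
  unfold qSumT
  rw [← Finset.sum_sub_distrib]
  refine Finset.sum_congr rfl fun q _ => ?_
  simp only [Pi.sub_apply]
  ring

/-- Subadditivity pattern: `∑∑ |f − g| ≤ ∑∑ |f| + ∑∑ |g|`. [folklore] -/
private theorem sum_sum_abs_sub_le {SR : Finset ℕ} {SL : ℕ → Finset ℕ} (f g : ℕ → ℕ → ℝ) :
    ∑ r ∈ SR, ∑ l ∈ SL r, |f r l - g r l| ≤
      ∑ r ∈ SR, ∑ l ∈ SL r, |f r l| + ∑ r ∈ SR, ∑ l ∈ SL r, |g r l| := by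
  rw [← Finset.sum_add_distrib]
  refine Finset.sum_le_sum fun r _ => ?_
  rw [← Finset.sum_add_distrib]
  exact Finset.sum_le_sum fun l _ => abs_sub _ _

/-- **Subadditivity in `α`**: `Δ(α₁ − α₂, β, γ) ≤ Δ(α₁, β, γ) + Δ(α₂, β, γ)`. [folklore] -/
theorem tripleT_sub_le_alpha (a : ℤ) (Xm Xn Xq : ℕ) (α₁ α₂ β γ : ℕ → ℝ) (L R : ℝ) :
    tripleT a Xm Xn Xq (α₁ - α₂) β γ L R ≤
      tripleT a Xm Xn Xq α₁ β γ L R + tripleT a Xm Xn Xq α₂ β γ L R := by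
  unfold tripleT
  simp only [qSumT_sub_alpha]
  exact sum_sum_abs_sub_le _ _

/-- **Subadditivity in `β`**. [folklore] -/
theorem tripleT_sub_le_beta (a : ℤ) (Xm Xn Xq : ℕ) (α β₁ β₂ γ : ℕ → ℝ) (L R : ℝ) :
    tripleT a Xm Xn Xq α (β₁ - β₂) γ L R ≤
      tripleT a Xm Xn Xq α β₁ γ L R + tripleT a Xm Xn Xq α β₂ γ L R := by
  unfold tripleT
  simp only [qSumT_sub_beta]
  exact sum_sum_abs_sub_le _ _

/-- **Subadditivity in `γ`**. [folklore] -/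
theorem tripleT_sub_le_gamma (a : ℤ) (Xm Xn Xq : ℕ) (α β γ₁ γ₂ : ℕ → ℝ) (L R : ℝ) :
    tripleT a Xm Xn Xq α β (γ₁ - γ₂) L R ≤
      tripleT a Xm Xn Xq α β γ₁ L R + tripleT a Xm Xn Xq α β γ₂ L R := by
  unfold tripleT
  simp only [qSumT_sub_gamma]
  exact sum_sum_abs_sub_le _ _

/-- `f − (f − g) = g` bookkeeping: `Δ(g) ≤ Δ(f) + Δ(f − g)` in `α`. [folklore] -/
theorem tripleT_le_add_sub_alpha (a : ℤ) (Xm Xn Xq : ℕ) (f g β γ : ℕ → ℝ) (L R : ℝ) :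
    tripleT a Xm Xn Xq g β γ L R ≤
      tripleT a Xm Xn Xq f β γ L R + tripleT a Xm Xn Xq (f - g) β γ L R := by
  have h := tripleT_sub_le_alpha a Xm Xn Xq f (f - g) β γ L R
  rwa [sub_sub_cancel] at h

/-- `Δ(g) ≤ Δ(f) + Δ(f − g)` in `β`. [folklore] -/
theorem tripleT_le_add_sub_beta (a : ℤ) (Xm Xn Xq : ℕ) (α f g γ : ℕ → ℝ) (L R : ℝ) :
    tripleT a Xm Xn Xq α g γ L R ≤
      tripleT a Xm Xn Xq α f γ L R + tripleT a Xm Xn Xq α (f - g) γ L R := by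
  have h := tripleT_sub_le_beta a Xm Xn Xq α f (f - g) γ L R
  rwa [sub_sub_cancel] at h

/-- `Δ(g) ≤ Δ(f) + Δ(f − g)` in `γ`. [folklore] -/
theorem tripleT_le_add_sub_gamma (a : ℤ) (Xm Xn Xq : ℕ) (α β f g : ℕ → ℝ) (L R : ℝ) :
    tripleT a Xm Xn Xq α β g L R ≤
      tripleT a Xm Xn Xq α β f L R + tripleT a Xm Xn Xq α β (f - g) L R := by
  have h := tripleT_sub_le_gamma a Xm Xn Xq α β f (f - g) L R
  rwa [sub_sub_cancel] at h

/-! ### The symmetry `m ↔ n` -/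

/-- `congrW` is symmetric in `(α, m) ↔ (β, n)`. [folklore] -/
theorem congrW_swap (a : ℤ) (Xm Xn : ℕ) (α β : ℕ → ℝ) (l d : ℕ) :
    congrW a Xm Xn α β l d = congrW a Xn Xm β α l d := by
  unfold congrW
  rw [Finset.sum_comm]
  refine Finset.sum_congr rfl fun n _ => Finset.sum_congr rfl fun m _ => ?_
  rw [show l * m * n = l * n * m by ring, mul_comm (α m) (β n)]

/-- `coprW` is symmetric in `(α, m) ↔ (β, n)`. [folklore] -/
theorem coprW_swap (Xm Xn : ℕ) (α β : ℕ → ℝ) (d : ℕ) :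
    coprW Xm Xn α β d = coprW Xn Xm β α d := by
  unfold coprW
  rw [Finset.sum_comm]
  refine Finset.sum_congr rfl fun n _ => Finset.sum_congr rfl fun m _ => ?_
  rw [mul_comm m n, mul_comm (α m) (β n)]

/-- **`Δ` is symmetric in the two smoothed variables `m`, `n`.** [folklore] -/
theorem tripleT_swap (a : ℤ) (Xm Xn Xq : ℕ) (α β γ : ℕ → ℝ) (L R : ℝ) :
    tripleT a Xm Xn Xq α β γ L R = tripleT a Xn Xm Xq β α γ L R := by
  unfold tripleT qSumT bracketT
  simp only [congrW_swap a Xm Xn α β, coprW_swap Xm Xn α β]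

/-! ### Indicator weights: the link with `BFI.deltaStarSets` -/

/-- A double sum over `Icc 1 Xm × Icc 1 Xn` with indicator weights of `SM ⊆ Icc 1 Xm`,
`SN ⊆ Icc 1 Xn` is the double sum over `SM × SN`. [folklore] -/
theorem sum_sum_ite_ind_eq {Xm Xn : ℕ} {SM SN : Finset ℕ} (hM : SM ⊆ Icc 1 Xm) (hN : SN ⊆ Icc 1 Xn)
    (P : ℕ → ℕ → Prop) [∀ m n, Decidable (P m n)] :
    ∑ m ∈ Icc 1 Xm, ∑ n ∈ Icc 1 Xn, (if P m n then ind SM m * ind SN n else 0) =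
      ∑ m ∈ SM, ∑ n ∈ SN, (if P m n then (1 : ℝ) else 0) := by
  symm
  rw [← Finset.sum_subset hM]
  · refine Finset.sum_congr rfl fun m hm => ?_
    rw [← Finset.sum_subset hN]
    · refine Finset.sum_congr rfl fun n hn => ?_
      rw [ind_of_mem hm, ind_of_mem hn, mul_one]
    · intro n _ hn
      rw [ind_of_not_mem hn, mul_zero, ite_self]
  · intro m _ hm
    refine Finset.sum_eq_zero fun n _ => ?_
    rw [ind_of_not_mem hm, zero_mul, ite_self]

/-- **For `z ≤ 2`, `deltaStarSets` on sets inside the cut-offs is `tripleT` with indicator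
weights.** [folklore] -/
theorem deltaStarSets_eq_tripleT {z : ℝ} (hz : z ≤ 2) (a : ℤ) {Xm Xn Xq : ℕ} {SM SN SQ : Finset ℕ}
    (hM : SM ⊆ Icc 1 Xm) (hN : SN ⊆ Icc 1 Xn) (hQ : SQ ⊆ Icc 1 Xq) (L R : ℝ) :
    deltaStarSets a z SM SN (dyadic L) SQ (dyadic R) =
      tripleT a Xm Xn Xq (ind SM) (ind SN) (ind SQ) L R := by
  unfold deltaStarSets tripleT
  refine Finset.sum_congr rfl fun r _ => Finset.sum_congr rfl fun l _ => ?_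
  rw [roughIndicator_of_le_two hz, one_mul]
  congr 1
  unfold setQSum qSumT
  -- the `q`-sum: indicator of `SQ`
  symm
  rw [← Finset.sum_subset (Finset.filter_subset_filter _ hQ)]
  · refine Finset.sum_congr rfl fun q hq => ?_
    rw [ind_of_mem (Finset.mem_filter.1 hq).1, one_mul]
    unfold bracketT setCongrCount setCoprimeCount congrW coprW
    simp only [roughIndicator_of_le_two hz, mul_one]
    rw [sum_sum_ite_ind_eq hM hN, sum_sum_ite_ind_eq hM hN]
  · intro q hq hq'
    have hqS : q ∉ SQ := fun h => hq' (Finset.mem_filter.2 ⟨h, (Finset.mem_filter.1 hq).2⟩)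
    rw [ind_of_not_mem hqS, zero_mul]

/-! ### Trivial bounds: generalities -/

/-- `#(m ∼ M) ≤ 2M` for `M ≥ 0`. [folklore] -/
theorem card_dyadic_le_two_mul {M : ℝ} (hM : 0 ≤ M) : ((dyadic M).card : ℝ) ≤ 2 * M := by
  calc ((dyadic M).card : ℝ) ≤ ((Icc 1 ⌊2 * M⌋₊).card : ℝ) := by
        exact_mod_cast Finset.card_le_card (dyadic_subset_Icc hM)
    _ = ⌊2 * M⌋₊ := by rw [Nat.card_Icc, Nat.add_sub_cancel]
    _ ≤ 2 * M := Nat.floor_le (by linarith)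

/-- `1 + log n ≤ 1 + log Y` for a natural number `n ≤ Y`, `Y ≥ 1` (also for `n = 0`). [folklore] -/
theorem one_add_log_natCast_le {n : ℕ} {Y : ℝ} (hY : 1 ≤ Y) (hn : (n : ℝ) ≤ Y) :
    1 + Real.log n ≤ 1 + Real.log Y := by
  rcases Nat.eq_zero_or_pos n with rfl | hn0
  · simp only [Nat.cast_zero, Real.log_zero, add_zero]
    linarith [Real.log_nonneg hY]
  · have : (0 : ℝ) < n := by exact_mod_cast hn0
    linarith [Real.log_le_log this hn]

/-- The logarithmic factor is `≪ X^δ`: `(1 + log(2X))⁴ ≤ C_δ X^δ` for `X ≥ 1`. [folklore] -/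
theorem one_add_log_pow_four_le {δ : ℝ} (hδ : 0 < δ) :
    ∃ C : ℝ, 0 < C ∧ ∀ X : ℝ, 1 ≤ X → (1 + Real.log (2 * X)) ^ 4 ≤ C * X ^ δ := by
  set η : ℝ := min δ 1 / 8 with hη
  have hη0 : 0 < η := by positivity
  have hη1 : 4 * η ≤ 1 / 2 := by
    have : min δ 1 ≤ 1 := min_le_right _ _
    rw [hη]; linarith
  have hηδ : 4 * η ≤ δ := by
    have : min δ 1 ≤ δ := min_le_left _ _
    rw [hη]; linarith
  refine ⟨(1 + 1 / η) ^ 4 * 2, by positivity, fun X hX => ?_⟩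
  have h2X : (1 : ℝ) ≤ 2 * X := by linarith
  -- `1 + log y ≤ (1 + 1/η) y^η` (cf. `Iwaniec1978.one_add_log_le` in the tree)
  have h1 : 1 + Real.log (2 * X) ≤ (1 + 1 / η) * (2 * X) ^ η := by
    have hl : Real.log (2 * X) ≤ (2 * X) ^ η / η := Real.log_le_rpow_div (by linarith) hη0
    have hp : (1 : ℝ) ≤ (2 * X) ^ η := Real.one_le_rpow h2X hη0.le
    calc 1 + Real.log (2 * X) ≤ (2 * X) ^ η + (2 * X) ^ η / η := add_le_add hp hl
      _ = (1 + 1 / η) * (2 * X) ^ η := by ring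
  have h0 : 0 ≤ 1 + Real.log (2 * X) := by linarith [Real.log_nonneg h2X]
  calc (1 + Real.log (2 * X)) ^ 4 ≤ ((1 + 1 / η) * (2 * X) ^ η) ^ 4 := by gcongr
    _ = (1 + 1 / η) ^ 4 * ((2 : ℝ) ^ (4 * η) * X ^ (4 * η)) := by
        rw [mul_pow, Real.mul_rpow (by norm_num) (by linarith), mul_pow, ← Real.rpow_natCast ((2:ℝ) ^ η) 4,
          ← Real.rpow_natCast (X ^ η) 4, ← Real.rpow_mul (by norm_num), ← Real.rpow_mul (by linarith)]
        push_cast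
        ring_nf
    _ ≤ (1 + 1 / η) ^ 4 * (2 * X ^ δ) := by
        have h2 : (2 : ℝ) ^ (4 * η) ≤ 2 := by
          calc (2 : ℝ) ^ (4 * η) ≤ (2 : ℝ) ^ (1 : ℝ) :=
                Real.rpow_le_rpow_of_exponent_le (by norm_num) (by linarith)
            _ = 2 := Real.rpow_one 2
        have h3 : X ^ (4 * η) ≤ X ^ δ := Real.rpow_le_rpow_of_exponent_le hX hηδ
        exact mul_le_mul_of_nonneg_left (mul_le_mul h2 h3 (by positivity) (by norm_num)) (by positivity)
    _ = (1 + 1 / η) ^ 4 * 2 * X ^ δ := by ring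

/-- The divisor factor is `≪ X^δ`: `τ(K)² ≤ C_δ X^δ` for `1 ≤ K ≤ 3X³`. [folklore] -/
theorem sigma_zero_sq_le_rpow {δ : ℝ} (hδ : 0 < δ) :
    ∃ C : ℝ, 0 < C ∧ ∀ (K : ℕ) (X : ℝ), 1 ≤ X → (K : ℝ) ≤ 3 * X ^ 3 → (σ 0 K : ℝ) ^ 2 ≤ C * X ^ δ := by
  set η : ℝ := min δ 1 / 8 with hη
  have hη0 : 0 < η := by positivity
  have hη1 : 2 * η ≤ 1 / 4 := by
    have : min δ 1 ≤ 1 := min_le_right _ _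
    rw [hη]; linarith
  have hηδ : 6 * η ≤ δ := by
    have : min δ 1 ≤ δ := min_le_left _ _
    rw [hη]; linarith
  obtain ⟨Cτ, hCτ1, hCτ⟩ := exists_sigma_zero_le_mul_rpow hη0
  refine ⟨Cτ ^ 2 * 3, by positivity, fun K X hX hK => ?_⟩
  have hX0 : 0 < X := by linarith
  have hK0 : (0 : ℝ) ≤ K := Nat.cast_nonneg K
  calc (σ 0 K : ℝ) ^ 2 ≤ (Cτ * (K : ℝ) ^ η) ^ 2 := by
        gcongr
        exact hCτ K
    _ ≤ (Cτ * (3 * X ^ 3) ^ η) ^ 2 := by gcongr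
    _ = Cτ ^ 2 * ((3 : ℝ) ^ (2 * η) * X ^ (6 * η)) := by
        rw [mul_pow, Real.mul_rpow (by norm_num) (by positivity), mul_pow,
          ← Real.rpow_natCast ((3:ℝ) ^ η) 2, ← Real.rpow_natCast ((X ^ 3) ^ η) 2,
          ← Real.rpow_mul (by norm_num), ← Real.rpow_natCast X 3, ← Real.rpow_mul hX0.le,
          ← Real.rpow_mul hX0.le]
        push_cast
        ring_nf
    _ ≤ Cτ ^ 2 * (3 * X ^ δ) := by
        have h2 : (3 : ℝ) ^ (2 * η) ≤ 3 := by
          calc (3 : ℝ) ^ (2 * η) ≤ (3 : ℝ) ^ (1 : ℝ) :=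
                Real.rpow_le_rpow_of_exponent_le (by norm_num) (by linarith)
            _ = 3 := Real.rpow_one 3
        have h3 : X ^ (6 * η) ≤ X ^ δ := Real.rpow_le_rpow_of_exponent_le hX hηδ
        exact mul_le_mul_of_nonneg_left (mul_le_mul h2 h3 (by positivity) (by norm_num)) (by positivity)
    _ = Cτ ^ 2 * 3 * X ^ δ := by ring

/-- Dropping the coprimality filters and the weight `|γ| ≤ 1`:
`Δ ≤ ∑_{r∼R} ∑_{l∼L} ∑_{q ≤ Xq} (|congrW(qr)| + |coprW(qr)|/φ(qr))`. [folklore] -/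
theorem tripleT_le_sum_abs (a : ℤ) (Xm Xn Xq : ℕ) (α β : ℕ → ℝ) {γ : ℕ → ℝ} (hγ : ∀ q, |γ q| ≤ 1)
    (L R : ℝ) :
    tripleT a Xm Xn Xq α β γ L R ≤
      ∑ r ∈ dyadic R, ∑ l ∈ dyadic L, ∑ q ∈ Icc 1 Xq,
        (|congrW a Xm Xn α β l (q * r)| + |coprW Xm Xn α β (q * r)| / (Nat.totient (q * r) : ℝ)) := by
  unfold tripleT
  calc _ ≤ ∑ r ∈ dyadic R, ∑ l ∈ (dyadic L).filter (fun l : ℕ => l.Coprime r),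
          |qSumT a Xm Xn Xq α β γ r l| :=
        Finset.sum_le_sum_of_subset_of_nonneg (Finset.filter_subset _ _) fun r _ _ =>
          Finset.sum_nonneg fun l _ => abs_nonneg _
    _ ≤ ∑ r ∈ dyadic R, ∑ l ∈ dyadic L, |qSumT a Xm Xn Xq α β γ r l| :=
        Finset.sum_le_sum fun r _ => Finset.sum_le_sum_of_subset_of_nonneg (Finset.filter_subset _ _)
          fun l _ _ => abs_nonneg _
    _ ≤ _ := Finset.sum_le_sum fun r _ => Finset.sum_le_sum fun l _ => ?_
  unfold qSumT
  calc |∑ q ∈ (Icc 1 Xq).filter (fun q : ℕ => IsCoprime (q : ℤ) (a * l)), γ q * bracketT a Xm Xn α β l (q * r)|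
      ≤ ∑ q ∈ (Icc 1 Xq).filter (fun q : ℕ => IsCoprime (q : ℤ) (a * l)),
          |γ q * bracketT a Xm Xn α β l (q * r)| := Finset.abs_sum_le_sum_abs _ _
    _ ≤ ∑ q ∈ Icc 1 Xq, |γ q * bracketT a Xm Xn α β l (q * r)| :=
        Finset.sum_le_sum_of_subset_of_nonneg (Finset.filter_subset _ _) fun q _ _ => abs_nonneg _
    _ ≤ _ := Finset.sum_le_sum fun q _ => ?_
  rw [abs_mul]
  calc |γ q| * |bracketT a Xm Xn α β l (q * r)| ≤ 1 * |bracketT a Xm Xn α β l (q * r)| :=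
        mul_le_mul_of_nonneg_right (hγ q) (abs_nonneg _)
    _ = |congrW a Xm Xn α β l (q * r) - coprW Xm Xn α β (q * r) / (Nat.totient (q * r) : ℝ)| := by
        rw [one_mul]; rfl
    _ ≤ |congrW a Xm Xn α β l (q * r)| + |coprW Xm Xn α β (q * r) / (Nat.totient (q * r) : ℝ)| :=
        abs_sub _ _
    _ = _ := by rw [abs_div, Nat.abs_cast]

/-- `|α(m) β(n)| ≤ 1` for weights bounded by `1`. [folklore] -/
theorem abs_mul_le_one_of {α β : ℕ → ℝ} (hα : ∀ m, |α m| ≤ 1) (hβ : ∀ n, |β n| ≤ 1) (m n : ℕ) :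
    |α m * β n| ≤ 1 := by
  rw [abs_mul]
  calc |α m| * |β n| ≤ 1 * 1 := mul_le_mul (hα m) (hβ n) (abs_nonneg _) zero_le_one
    _ = 1 := one_mul 1

/-- The congruence count with a thin weight `α` (supported on `T`, `|α|, |β| ≤ 1`) is at most the
number of `(m, n)`, `m ∈ T`, with `d ∣ lmn − a`. [folklore] -/
theorem abs_congrW_le_of_thin {α β : ℕ → ℝ} {T : Finset ℕ} (hα : ∀ m, |α m| ≤ 1)
    (hαT : ∀ m, α m ≠ 0 → m ∈ T) (hβ : ∀ n, |β n| ≤ 1) (a : ℤ) (Xm Xn l d : ℕ) :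
    |congrW a Xm Xn α β l d| ≤
      ∑ m ∈ (Icc 1 Xm).filter (· ∈ T), ∑ n ∈ Icc 1 Xn,
        (if (d : ℤ) ∣ ((l * m * n : ℕ) : ℤ) - a then (1 : ℝ) else 0) := by
  unfold congrW
  refine (Finset.abs_sum_le_sum_abs _ _).trans ?_
  rw [← Finset.sum_filter_add_sum_filter_not (Icc 1 Xm) (· ∈ T)]
  have hzero : ∑ m ∈ (Icc 1 Xm).filter (fun m => ¬ m ∈ T), |∑ n ∈ Icc 1 Xn,
      (if ((l * m * n : ℕ) : ZMod d) = (a : ZMod d) then α m * β n else 0)| = 0 := by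
    refine Finset.sum_eq_zero fun m hm => ?_
    have hm' : α m = 0 := by
      by_contra h
      exact (Finset.mem_filter.1 hm).2 (hαT m h)
    rw [abs_eq_zero]
    exact Finset.sum_eq_zero fun n _ => by rw [hm', zero_mul, ite_self]
  rw [hzero, add_zero]
  refine Finset.sum_le_sum fun m _ => (Finset.abs_sum_le_sum_abs _ _).trans
    (Finset.sum_le_sum fun n _ => ?_)
  by_cases h : ((l * m * n : ℕ) : ZMod d) = (a : ZMod d)
  · rw [if_pos h, if_pos (int_dvd_of_natCast_mul_eq h)]
    exact abs_mul_le_one_of hα hβ m n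
  · rw [if_neg h, abs_zero]
    split_ifs <;> norm_num

/-- The coprimality count with a thin weight: `|coprW| ≤ #T · Xn`. [folklore] -/
theorem abs_coprW_le_of_thin {α β : ℕ → ℝ} {T : Finset ℕ} (hα : ∀ m, |α m| ≤ 1)
    (hαT : ∀ m, α m ≠ 0 → m ∈ T) (hβ : ∀ n, |β n| ≤ 1) (Xm Xn d : ℕ) :
    |coprW Xm Xn α β d| ≤ (T.card : ℝ) * Xn := by
  unfold coprW
  refine (Finset.abs_sum_le_sum_abs _ _).trans ?_
  rw [← Finset.sum_filter_add_sum_filter_not (Icc 1 Xm) (· ∈ T)]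
  have hzero : ∑ m ∈ (Icc 1 Xm).filter (fun m => ¬ m ∈ T), |∑ n ∈ Icc 1 Xn,
      (if (m * n).Coprime d then α m * β n else 0)| = 0 := by
    refine Finset.sum_eq_zero fun m hm => ?_
    have hm' : α m = 0 := by
      by_contra h
      exact (Finset.mem_filter.1 hm).2 (hαT m h)
    rw [abs_eq_zero]
    exact Finset.sum_eq_zero fun n _ => by rw [hm', zero_mul, ite_self]
  rw [hzero, add_zero]
  calc ∑ m ∈ (Icc 1 Xm).filter (· ∈ T), |∑ n ∈ Icc 1 Xn, (if (m * n).Coprime d then α m * β n else 0)|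
      ≤ ∑ m ∈ (Icc 1 Xm).filter (· ∈ T), ∑ _n ∈ Icc 1 Xn, (1 : ℝ) := by
        refine Finset.sum_le_sum fun m _ => (Finset.abs_sum_le_sum_abs _ _).trans
          (Finset.sum_le_sum fun n _ => ?_)
        split_ifs
        · exact abs_mul_le_one_of hα hβ m n
        · rw [abs_zero]; norm_num
    _ = (((Icc 1 Xm).filter (fun m : ℕ => m ∈ T)).card : ℝ) * Xn := by
        simp only [Finset.sum_const, Nat.card_Icc, Nat.add_sub_cancel, nsmul_eq_mul, mul_one]
    _ ≤ (T.card : ℝ) * Xn := by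
        gcongr
        exact fun m (hm : m ∈ (Icc 1 Xm).filter (fun m : ℕ => m ∈ T)) => (Finset.mem_filter.1 hm).2

/-- `∑_{r∼R} ∑_{q ≤ Xq} 1/φ(qr) ≤ (1 + log Xq)² (1 + log ⌊2R⌋)²` (`φ(qr) ≥ φ(q)φ(r)`). [folklore] -/
theorem sum_dyadic_sum_Icc_inv_totient_le {R : ℝ} (hR : 0 ≤ R) (Xq : ℕ) :
    ∑ r ∈ dyadic R, ∑ q ∈ Icc 1 Xq, ((Nat.totient (q * r) : ℝ))⁻¹ ≤
      (1 + Real.log Xq) ^ 2 * (1 + Real.log ⌊2 * R⌋₊) ^ 2 := by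
  have hφ : ∀ q r : ℕ, 1 ≤ q → 1 ≤ r →
      ((Nat.totient (q * r) : ℝ))⁻¹ ≤ ((Nat.totient q : ℝ))⁻¹ * ((Nat.totient r : ℝ))⁻¹ := by
    intro q r hq hr
    have hq0 : (0 : ℝ) < Nat.totient q := by exact_mod_cast Nat.totient_pos.2 hq
    have hr0 : (0 : ℝ) < Nat.totient r := by exact_mod_cast Nat.totient_pos.2 hr
    rw [← mul_inv, inv_le_inv₀ (by exact_mod_cast Nat.totient_pos.2 (Nat.mul_pos hq hr)) (mul_pos hq0 hr0)]
    exact_mod_cast Nat.totient_super_multiplicative q r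
  calc ∑ r ∈ dyadic R, ∑ q ∈ Icc 1 Xq, ((Nat.totient (q * r) : ℝ))⁻¹
      ≤ ∑ r ∈ Icc 1 ⌊2 * R⌋₊, ∑ q ∈ Icc 1 Xq, ((Nat.totient (q * r) : ℝ))⁻¹ :=
        Finset.sum_le_sum_of_subset_of_nonneg (dyadic_subset_Icc hR) fun r _ _ =>
          Finset.sum_nonneg fun q _ => inv_nonneg.2 (Nat.cast_nonneg _)
    _ ≤ ∑ r ∈ Icc 1 ⌊2 * R⌋₊, ∑ q ∈ Icc 1 Xq, ((Nat.totient q : ℝ))⁻¹ * ((Nat.totient r : ℝ))⁻¹ := by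
        refine Finset.sum_le_sum fun r hr => Finset.sum_le_sum fun q hq => ?_
        exact hφ q r (Finset.mem_Icc.1 hq).1 (Finset.mem_Icc.1 hr).1
    _ = (∑ q ∈ Icc 1 Xq, ((Nat.totient q : ℝ))⁻¹) * ∑ r ∈ Icc 1 ⌊2 * R⌋₊, ((Nat.totient r : ℝ))⁻¹ := by
        rw [Finset.sum_mul_sum, Finset.sum_comm]
    _ ≤ (1 + Real.log Xq) ^ 2 * (1 + Real.log ⌊2 * R⌋₊) ^ 2 :=
        mul_le_mul (totientInvSum_le Xq) (totientInvSum_le _)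
          (Finset.sum_nonneg fun r _ => inv_nonneg.2 (Nat.cast_nonneg _)) (by positivity)

/-- Reordering a fivefold sum: `∑_r ∑_l ∑_q ∑_m ∑_n = ∑_l ∑_m ∑_n ∑_r ∑_q`. [folklore] -/
theorem sum5_reorder (SR SL SQ SM SN : Finset ℕ) (f : ℕ → ℕ → ℕ → ℕ → ℕ → ℝ) :
    ∑ r ∈ SR, ∑ l ∈ SL, ∑ q ∈ SQ, ∑ m ∈ SM, ∑ n ∈ SN, f r l q m n =
      ∑ l ∈ SL, ∑ m ∈ SM, ∑ n ∈ SN, ∑ r ∈ SR, ∑ q ∈ SQ, f r l q m n := by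
  rw [Finset.sum_comm]
  refine Finset.sum_congr rfl fun l _ => ?_
  calc ∑ r ∈ SR, ∑ q ∈ SQ, ∑ m ∈ SM, ∑ n ∈ SN, f r l q m n
      = ∑ r ∈ SR, ∑ m ∈ SM, ∑ q ∈ SQ, ∑ n ∈ SN, f r l q m n :=
        Finset.sum_congr rfl fun r _ => Finset.sum_comm
    _ = ∑ m ∈ SM, ∑ r ∈ SR, ∑ q ∈ SQ, ∑ n ∈ SN, f r l q m n := Finset.sum_comm
    _ = ∑ m ∈ SM, ∑ r ∈ SR, ∑ n ∈ SN, ∑ q ∈ SQ, f r l q m n :=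
        Finset.sum_congr rfl fun m _ => Finset.sum_congr rfl fun r _ => Finset.sum_comm
    _ = ∑ m ∈ SM, ∑ n ∈ SN, ∑ r ∈ SR, ∑ q ∈ SQ, f r l q m n :=
        Finset.sum_congr rfl fun m _ => Finset.sum_comm

/-- **The trivial bound for a thin weight `α`** (the mechanism of BFI (12.1)/(14.3)): if `|α| ≤ 1`
is supported on a set `T` of integers `m > a`, `|β|, |γ| ≤ 1`, and all sizes are `≤ X`, then for
every `δ > 0`, `Δ(α, β, γ) ≤ C_δ X^δ · #T · (2L + 1) · Xn`: each `(l, m, n)` with `m ∈ T` admits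
at most `τ(lmn − a)² ≤ C X^{δ}` pairs `(q, r)` with `qr ∣ lmn − a`, and the expected parts are
`≤ #T · Xn / φ(qr)` with `∑∑ 1/φ(qr) ≤ (1 + log X)²(1 + log 2X)²`.
[cite: BombieriFriedlanderIwaniecActa1986, §12 (12.1) p. 236; §14 (14.3) p. 245] -/
theorem tripleT_le_of_thin_alpha {δ : ℝ} (hδ : 0 < δ) :
    ∃ C : ℝ, 0 < C ∧ ∀ (a : ℤ) (Xm Xn Xq : ℕ) (T : Finset ℕ) (α β γ : ℕ → ℝ) (L R X : ℝ),
      0 ≤ L → 0 ≤ R → 1 ≤ X → (Xm : ℝ) ≤ X → (Xn : ℝ) ≤ X → (Xq : ℝ) ≤ X → L ≤ X → R ≤ X →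
      |(a : ℝ)| ≤ X → (∀ m ∈ T, a < (m : ℤ)) →
      (∀ m, |α m| ≤ 1) → (∀ m, α m ≠ 0 → m ∈ T) → (∀ n, |β n| ≤ 1) → (∀ q, |γ q| ≤ 1) →
      tripleT a Xm Xn Xq α β γ L R ≤ C * X ^ δ * T.card * (2 * L + 1) * Xn := by
  obtain ⟨Cσ, hCσ, hσ⟩ := sigma_zero_sq_le_rpow hδ
  obtain ⟨Cl, hCl, hlog⟩ := one_add_log_pow_four_le hδ
  refine ⟨Cσ + Cl, by positivity, ?_⟩
  intro a Xm Xn Xq T α β γ L R X hL hR hX hXm hXn hXq hLX hRX haX hTa hα hαT hβ hγ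
  have hX0 : 0 < X := by linarith
  refine (tripleT_le_sum_abs a Xm Xn Xq α β hγ L R).trans ?_
  rw [show ∑ r ∈ dyadic R, ∑ l ∈ dyadic L, ∑ q ∈ Icc 1 Xq,
        (|congrW a Xm Xn α β l (q * r)| + |coprW Xm Xn α β (q * r)| / (Nat.totient (q * r) : ℝ)) =
      (∑ r ∈ dyadic R, ∑ l ∈ dyadic L, ∑ q ∈ Icc 1 Xq, |congrW a Xm Xn α β l (q * r)|) +
        ∑ r ∈ dyadic R, ∑ l ∈ dyadic L, ∑ q ∈ Icc 1 Xq,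
          |coprW Xm Xn α β (q * r)| / (Nat.totient (q * r) : ℝ) by
    simp only [Finset.sum_add_distrib]]
  set TM : Finset ℕ := (Icc 1 Xm).filter (· ∈ T) with hTM
  have hTMcard : (TM.card : ℝ) ≤ T.card := by
    exact_mod_cast Finset.card_le_card fun m hm => (Finset.mem_filter.1 hm).2
  have hdyL : ((dyadic L).card : ℝ) ≤ 2 * L + 1 := by linarith [card_dyadic_le_two_mul hL]
  -- Step 1: the congruence part
  have hA : ∑ r ∈ dyadic R, ∑ l ∈ dyadic L, ∑ q ∈ Icc 1 Xq, |congrW a Xm Xn α β l (q * r)| ≤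
      Cσ * X ^ δ * T.card * (2 * L + 1) * Xn := by
    -- pointwise divisor-count bound for one `(l, m, n)`
    have hone : ∀ l ∈ dyadic L, ∀ m ∈ TM, ∀ n ∈ Icc 1 Xn,
        ∑ r ∈ dyadic R, ∑ q ∈ Icc 1 Xq,
            (if ((q * r : ℕ) : ℤ) ∣ ((l * m * n : ℕ) : ℤ) - a then (1 : ℝ) else 0) ≤ Cσ * X ^ δ := by
      intro l hl m hm n hn
      have hl' := (mem_dyadic hL).1 hl
      have hmT : m ∈ T := (Finset.mem_filter.1 hm).2
      have hmX : m ≤ Xm := (Finset.mem_Icc.1 (Finset.mem_filter.1 hm).1).2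
      have hn1 : 1 ≤ n := (Finset.mem_Icc.1 hn).1
      have hnX : n ≤ Xn := (Finset.mem_Icc.1 hn).2
      have hl1 : 1 ≤ l := by
        have : (0 : ℝ) < l := hL.trans_lt hl'.1
        exact_mod_cast this
      set K : ℤ := ((l * m * n : ℕ) : ℤ) - a with hK
      have hKpos : 0 < K := by
        have h1 : (m : ℤ) ≤ ((l * m * n : ℕ) : ℤ) := by
          have : m ≤ l * m * n := by
            calc m = 1 * m * 1 := by ring
              _ ≤ l * m * n := Nat.mul_le_mul (Nat.mul_le_mul hl1 le_rfl) hn1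
          exact_mod_cast this
        have := hTa m hmT
        rw [hK]; linarith
      have hK0 : K ≠ 0 := hKpos.ne'
      have hKle : (K.natAbs : ℝ) ≤ 3 * X ^ 3 := by
        have h2 : ((K.natAbs : ℕ) : ℝ) = (K : ℝ) := by
          rw [Nat.cast_natAbs, abs_of_pos (by exact_mod_cast hKpos)]
        rw [h2, hK]
        push_cast
        have hl2 : (l : ℝ) ≤ 2 * L := hl'.2
        have hm' : (m : ℝ) ≤ X := le_trans (by exact_mod_cast hmX) hXm
        have hn' : (n : ℝ) ≤ X := le_trans (by exact_mod_cast hnX) hXn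
        have hl0 : (0 : ℝ) ≤ l := Nat.cast_nonneg l
        have hm0 : (0 : ℝ) ≤ m := Nat.cast_nonneg m
        have hn0 : (0 : ℝ) ≤ n := Nat.cast_nonneg n
        have hlm : (l : ℝ) * m ≤ 2 * L * X := mul_le_mul hl2 hm' hm0 (by positivity)
        have hlmn : (l : ℝ) * m * n ≤ 2 * L * X * X := mul_le_mul hlm hn' hn0 (by positivity)
        have ha' : -(a : ℝ) ≤ X := (neg_le_abs _).trans haX
        have hLXX : 2 * L * X * X ≤ 2 * X * X * X := by
          have : 0 ≤ X * X := by positivity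
          nlinarith
        have hX3 : X ≤ X * X * X := by nlinarith
        nlinarith
      calc ∑ r ∈ dyadic R, ∑ q ∈ Icc 1 Xq, (if ((q * r : ℕ) : ℤ) ∣ K then (1 : ℝ) else 0)
          ≤ ∑ r ∈ Icc 1 ⌊2 * R⌋₊, ∑ q ∈ Icc 1 Xq, (if ((q * r : ℕ) : ℤ) ∣ K then (1 : ℝ) else 0) :=
            Finset.sum_le_sum_of_subset_of_nonneg (dyadic_subset_Icc hR) fun r _ _ =>
              Finset.sum_nonneg fun q _ => by split_ifs <;> norm_num
        _ = ∑ q ∈ Icc 1 Xq, ∑ r ∈ Icc 1 ⌊2 * R⌋₊, (if ((q * r : ℕ) : ℤ) ∣ K then (1 : ℝ) else 0) :=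
            Finset.sum_comm
        _ ≤ (σ 0 K.natAbs : ℝ) ^ 2 := by
            have h := sum_sum_dvd_indicator_le Xq ⌊2 * R⌋₊ K
            rwa [if_neg hK0] at h
        _ ≤ Cσ * X ^ δ := hσ K.natAbs X hX hKle
    calc ∑ r ∈ dyadic R, ∑ l ∈ dyadic L, ∑ q ∈ Icc 1 Xq, |congrW a Xm Xn α β l (q * r)|
        ≤ ∑ r ∈ dyadic R, ∑ l ∈ dyadic L, ∑ q ∈ Icc 1 Xq, ∑ m ∈ TM, ∑ n ∈ Icc 1 Xn,
            (if ((q * r : ℕ) : ℤ) ∣ ((l * m * n : ℕ) : ℤ) - a then (1 : ℝ) else 0) :=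
          Finset.sum_le_sum fun r _ => Finset.sum_le_sum fun l _ => Finset.sum_le_sum fun q _ =>
            abs_congrW_le_of_thin hα hαT hβ a Xm Xn l (q * r)
      _ = ∑ l ∈ dyadic L, ∑ m ∈ TM, ∑ n ∈ Icc 1 Xn, ∑ r ∈ dyadic R, ∑ q ∈ Icc 1 Xq,
            (if ((q * r : ℕ) : ℤ) ∣ ((l * m * n : ℕ) : ℤ) - a then (1 : ℝ) else 0) :=
          sum5_reorder _ _ _ _ _ _
      _ ≤ ∑ l ∈ dyadic L, ∑ m ∈ TM, ∑ _n ∈ Icc 1 Xn, Cσ * X ^ δ :=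
          Finset.sum_le_sum fun l hl => Finset.sum_le_sum fun m hm => Finset.sum_le_sum fun n hn =>
            hone l hl m hm n hn
      _ = ((dyadic L).card : ℝ) * (TM.card * (Xn * (Cσ * X ^ δ))) := by
          simp only [Finset.sum_const, Nat.card_Icc, Nat.add_sub_cancel, nsmul_eq_mul]
      _ ≤ (2 * L + 1) * (T.card * (Xn * (Cσ * X ^ δ))) := by gcongr
      _ = Cσ * X ^ δ * T.card * (2 * L + 1) * Xn := by ring
  -- Step 2: the expected part
  have hB : ∑ r ∈ dyadic R, ∑ l ∈ dyadic L, ∑ q ∈ Icc 1 Xq,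
      |coprW Xm Xn α β (q * r)| / (Nat.totient (q * r) : ℝ) ≤ Cl * X ^ δ * T.card * (2 * L + 1) * Xn := by
    have hlogs : (1 + Real.log Xq) ^ 2 * (1 + Real.log ⌊2 * R⌋₊) ^ 2 ≤ Cl * X ^ δ := by
      have h1 : 1 + Real.log Xq ≤ 1 + Real.log (2 * X) :=
        one_add_log_natCast_le (by linarith) (hXq.trans (by linarith))
      have h2 : 1 + Real.log ⌊2 * R⌋₊ ≤ 1 + Real.log (2 * X) :=
        one_add_log_natCast_le (by linarith) ((Nat.floor_le (by linarith)).trans (by linarith))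
      have h01 : 0 ≤ 1 + Real.log (Xq : ℝ) := by
        rcases Nat.eq_zero_or_pos Xq with h | h
        · simp [h]
        · linarith [Real.log_nonneg (show (1 : ℝ) ≤ Xq by exact_mod_cast h)]
      have h02 : 0 ≤ 1 + Real.log (⌊2 * R⌋₊ : ℝ) := by
        rcases Nat.eq_zero_or_pos ⌊2 * R⌋₊ with h | h
        · simp [h]
        · linarith [Real.log_nonneg (show (1 : ℝ) ≤ ⌊2 * R⌋₊ by exact_mod_cast h)]
      calc (1 + Real.log Xq) ^ 2 * (1 + Real.log ⌊2 * R⌋₊) ^ 2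
          ≤ (1 + Real.log (2 * X)) ^ 2 * (1 + Real.log (2 * X)) ^ 2 := by gcongr
        _ = (1 + Real.log (2 * X)) ^ 4 := by ring
        _ ≤ Cl * X ^ δ := hlog X hX
    calc ∑ r ∈ dyadic R, ∑ l ∈ dyadic L, ∑ q ∈ Icc 1 Xq,
          |coprW Xm Xn α β (q * r)| / (Nat.totient (q * r) : ℝ)
        ≤ ∑ r ∈ dyadic R, ∑ _l ∈ dyadic L, ∑ q ∈ Icc 1 Xq,
            (T.card : ℝ) * Xn * ((Nat.totient (q * r) : ℝ))⁻¹ := by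
          refine Finset.sum_le_sum fun r _ => Finset.sum_le_sum fun l _ => Finset.sum_le_sum fun q _ => ?_
          rw [div_eq_mul_inv]
          exact mul_le_mul_of_nonneg_right (abs_coprW_le_of_thin hα hαT hβ Xm Xn (q * r))
            (inv_nonneg.2 (Nat.cast_nonneg _))
      _ = ((dyadic L).card : ℝ) * ((T.card : ℝ) * Xn *
            ∑ r ∈ dyadic R, ∑ q ∈ Icc 1 Xq, ((Nat.totient (q * r) : ℝ))⁻¹) := by
          simp_rw [Finset.mul_sum]
          refine Finset.sum_congr rfl fun r _ => ?_
          rw [Finset.sum_const, nsmul_eq_mul, Finset.mul_sum]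
      _ ≤ (2 * L + 1) * ((T.card : ℝ) * Xn * (Cl * X ^ δ)) := by
          have h0 : 0 ≤ ∑ r ∈ dyadic R, ∑ q ∈ Icc 1 Xq, ((Nat.totient (q * r) : ℝ))⁻¹ :=
            Finset.sum_nonneg fun r _ => Finset.sum_nonneg fun q _ => inv_nonneg.2 (Nat.cast_nonneg _)
          gcongr
          exact (sum_dyadic_sum_Icc_inv_totient_le hR Xq).trans hlogs
      _ = Cl * X ^ δ * T.card * (2 * L + 1) * Xn := by ring
  calc _ ≤ Cσ * X ^ δ * T.card * (2 * L + 1) * Xn + Cl * X ^ δ * T.card * (2 * L + 1) * Xn :=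
        add_le_add hA hB
    _ = (Cσ + Cl) * X ^ δ * T.card * (2 * L + 1) * Xn := by ring


/-! ### Trivial bounds: a thin weight on `q` -/

/-- With a thin weight `γ` (supported on `T`, `|γ| ≤ 1`) the `q`-sum may be restricted to `T`:
`Δ ≤ ∑_{r∼R} ∑_{l∼L} ∑_{q ≤ Xq, q ∈ T} (|congrW(qr)| + |coprW(qr)|/φ(qr))`. [folklore] -/
theorem tripleT_le_sum_abs_of_thin_gamma (a : ℤ) (Xm Xn Xq : ℕ) (α β : ℕ → ℝ) {γ : ℕ → ℝ}
    {T : Finset ℕ} (hγ : ∀ q, |γ q| ≤ 1) (hγT : ∀ q, γ q ≠ 0 → q ∈ T) (L R : ℝ) :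
    tripleT a Xm Xn Xq α β γ L R ≤
      ∑ r ∈ dyadic R, ∑ l ∈ dyadic L, ∑ q ∈ (Icc 1 Xq).filter (fun q : ℕ => q ∈ T),
        (|congrW a Xm Xn α β l (q * r)| + |coprW Xm Xn α β (q * r)| / (Nat.totient (q * r) : ℝ)) := by
  unfold tripleT
  calc _ ≤ ∑ r ∈ dyadic R, ∑ l ∈ (dyadic L).filter (fun l : ℕ => l.Coprime r),
          |qSumT a Xm Xn Xq α β γ r l| :=
        Finset.sum_le_sum_of_subset_of_nonneg (Finset.filter_subset _ _) fun r _ _ =>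
          Finset.sum_nonneg fun l _ => abs_nonneg _
    _ ≤ ∑ r ∈ dyadic R, ∑ l ∈ dyadic L, |qSumT a Xm Xn Xq α β γ r l| :=
        Finset.sum_le_sum fun r _ => Finset.sum_le_sum_of_subset_of_nonneg (Finset.filter_subset _ _)
          fun l _ _ => abs_nonneg _
    _ ≤ _ := Finset.sum_le_sum fun r _ => Finset.sum_le_sum fun l _ => ?_
  unfold qSumT
  calc |∑ q ∈ (Icc 1 Xq).filter (fun q : ℕ => IsCoprime (q : ℤ) (a * l)), γ q * bracketT a Xm Xn α β l (q * r)|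
      ≤ ∑ q ∈ (Icc 1 Xq).filter (fun q : ℕ => IsCoprime (q : ℤ) (a * l)),
          |γ q * bracketT a Xm Xn α β l (q * r)| := Finset.abs_sum_le_sum_abs _ _
    _ ≤ ∑ q ∈ Icc 1 Xq, |γ q * bracketT a Xm Xn α β l (q * r)| :=
        Finset.sum_le_sum_of_subset_of_nonneg (Finset.filter_subset _ _) fun q _ _ => abs_nonneg _
    _ = ∑ q ∈ (Icc 1 Xq).filter (fun q : ℕ => q ∈ T), |γ q * bracketT a Xm Xn α β l (q * r)| := by
        rw [Finset.sum_filter]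
        refine Finset.sum_congr rfl fun q _ => ?_
        by_cases hq : q ∈ T
        · rw [if_pos hq]
        · rw [if_neg hq]
          have : γ q = 0 := by by_contra h; exact hq (hγT q h)
          rw [this, zero_mul, abs_zero]
    _ ≤ _ := Finset.sum_le_sum fun q _ => ?_
  rw [abs_mul]
  calc |γ q| * |bracketT a Xm Xn α β l (q * r)| ≤ 1 * |bracketT a Xm Xn α β l (q * r)| :=
        mul_le_mul_of_nonneg_right (hγ q) (abs_nonneg _)
    _ = |congrW a Xm Xn α β l (q * r) - coprW Xm Xn α β (q * r) / (Nat.totient (q * r) : ℝ)| := by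
        rw [one_mul]; rfl
    _ ≤ |congrW a Xm Xn α β l (q * r)| + |coprW Xm Xn α β (q * r) / (Nat.totient (q * r) : ℝ)| :=
        abs_sub _ _
    _ = _ := by rw [abs_div, Nat.abs_cast]

/-- `|congrW| ≤ #{(m, n) : d ∣ lmn − a}` for weights bounded by `1`. [folklore] -/
theorem abs_congrW_le_count {α β : ℕ → ℝ} (hα : ∀ m, |α m| ≤ 1) (hβ : ∀ n, |β n| ≤ 1)
    (a : ℤ) (Xm Xn l d : ℕ) :
    |congrW a Xm Xn α β l d| ≤
      ∑ m ∈ Icc 1 Xm, ∑ n ∈ Icc 1 Xn, (if (d : ℤ) ∣ ((l * m * n : ℕ) : ℤ) - a then (1 : ℝ) else 0) := by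
  unfold congrW
  refine (Finset.abs_sum_le_sum_abs _ _).trans (Finset.sum_le_sum fun m _ =>
    (Finset.abs_sum_le_sum_abs _ _).trans (Finset.sum_le_sum fun n _ => ?_))
  by_cases h : ((l * m * n : ℕ) : ZMod d) = (a : ZMod d)
  · rw [if_pos h, if_pos (int_dvd_of_natCast_mul_eq h)]
    exact abs_mul_le_one_of hα hβ m n
  · rw [if_neg h, abs_zero]
    split_ifs <;> norm_num

/-- `|coprW| ≤ Xm · Xn` for weights bounded by `1`. [folklore] -/
theorem abs_coprW_le_mul {α β : ℕ → ℝ} (hα : ∀ m, |α m| ≤ 1) (hβ : ∀ n, |β n| ≤ 1) (Xm Xn d : ℕ) :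
    |coprW Xm Xn α β d| ≤ (Xm : ℝ) * Xn := by
  unfold coprW
  calc |∑ m ∈ Icc 1 Xm, ∑ n ∈ Icc 1 Xn, (if (m * n).Coprime d then α m * β n else 0)|
      ≤ ∑ m ∈ Icc 1 Xm, ∑ _n ∈ Icc 1 Xn, (1 : ℝ) := by
        refine (Finset.abs_sum_le_sum_abs _ _).trans (Finset.sum_le_sum fun m _ =>
          (Finset.abs_sum_le_sum_abs _ _).trans (Finset.sum_le_sum fun n _ => ?_))
        split_ifs
        · exact abs_mul_le_one_of hα hβ m n
        · rw [abs_zero]; norm_num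
    _ = (Xm : ℝ) * Xn := by
        simp only [Finset.sum_const, Nat.card_Icc, Nat.add_sub_cancel, nsmul_eq_mul, mul_one]

/-- The number of `k ∈ [1, K]` in one residue class modulo `d ≥ 1` is at most `K/d + 1`. [folklore] -/
theorem card_Icc_filter_natCast_eq_le (d K : ℕ) (c : ZMod d) :
    (((Icc 1 K).filter (fun k : ℕ => (k : ZMod d) = c)).card : ℝ) ≤ (K : ℝ) / d + 1 := by
  -- `k ↦ k / d` is injective on the class and lands in `[0, K/d]`
  have hinj : Set.InjOn (fun k : ℕ => k / d) ((Icc 1 K).filter (fun k : ℕ => (k : ZMod d) = c)) := by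
    intro k₁ hk₁ k₂ hk₂ h
    rw [Finset.coe_filter] at hk₁ hk₂
    have hm₁ : k₁ % d = c.val := by rw [← ZMod.val_natCast, hk₁.2]
    have hm₂ : k₂ % d = c.val := by rw [← ZMod.val_natCast, hk₂.2]
    have h' : k₁ / d = k₂ / d := h
    calc k₁ = d * (k₁ / d) + k₁ % d := (Nat.div_add_mod k₁ d).symm
      _ = d * (k₂ / d) + k₂ % d := by rw [h', hm₁, hm₂]
      _ = k₂ := Nat.div_add_mod k₂ d
  have hmaps : ∀ k ∈ (Icc 1 K).filter (fun k : ℕ => (k : ZMod d) = c), k / d ∈ Finset.range (K / d + 1) := by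
    intro k hk
    rw [Finset.mem_range, Nat.lt_add_one_iff]
    exact Nat.div_le_div_right (Finset.mem_Icc.1 (Finset.mem_filter.1 hk).1).2
  have hcard := Finset.card_le_card_of_injOn (fun k : ℕ => k / d) hmaps hinj
  rw [Finset.card_range] at hcard
  calc (((Icc 1 K).filter (fun k : ℕ => (k : ZMod d) = c)).card : ℝ) ≤ ((K / d + 1 : ℕ) : ℝ) := by
        exact_mod_cast hcard
    _ = ((K / d : ℕ) : ℝ) + 1 := by push_cast; ring
    _ ≤ (K : ℝ) / d + 1 := by
        gcongr
        exact Nat.cast_div_le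

/-- `∑_{r ∼ R} 1/r ≤ 2` for `R ≥ 0`. [folklore] -/
theorem sum_dyadic_one_div_le_two {R : ℝ} (hR : 0 ≤ R) : ∑ r ∈ dyadic R, (1 : ℝ) / r ≤ 2 := by
  rcases eq_or_lt_of_le hR with h | hR0
  · -- `R = 0`: the range is empty
    have : dyadic R = ∅ := by
      ext m
      simp only [Finset.notMem_empty, iff_false]
      intro hm
      have h1 := (mem_dyadic hR).1 hm
      rw [← h] at h1
      have : (0 : ℝ) < m := h1.1
      linarith [h1.2]
    rw [this, Finset.sum_empty]; norm_num
  · calc ∑ r ∈ dyadic R, (1 : ℝ) / r ≤ ∑ _r ∈ dyadic R, 1 / R := by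
          refine Finset.sum_le_sum fun r hr => ?_
          have h1 := ((mem_dyadic hR).1 hr).1
          exact one_div_le_one_div_of_le hR0 h1.le
      _ = ((dyadic R).card : ℝ) * (1 / R) := by rw [Finset.sum_const, nsmul_eq_mul]
      _ ≤ 2 * R * (1 / R) := by
          gcongr
          exact card_dyadic_le_two_mul hR
      _ = 2 := by field_simp

/-- **Counting `(l, m, n)` in a box with `d ∣ lmn − a`** through `k = lmn`: at most
`C_δ X^δ (K/d + 1)` where `K = ⌊2L⌋ Xm Xn` bounds `lmn` (`τ(k)² ≤ C X^δ` choices of `(l, m, n)` for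
each `k`, and `≤ K/d + 1` values of `k ≤ K` in the class of `a`). [folklore] -/
theorem sum_triple_dvd_indicator_le {δ : ℝ} (hδ : 0 < δ) :
    ∃ C : ℝ, 0 < C ∧ ∀ (a : ℤ) (Xm Xn : ℕ) (L X : ℝ) (d : ℕ), 0 ≤ L → 1 ≤ X →
      (Xm : ℝ) ≤ X → (Xn : ℝ) ≤ X → L ≤ X →
      ∑ l ∈ dyadic L, ∑ m ∈ Icc 1 Xm, ∑ n ∈ Icc 1 Xn,
          (if (d : ℤ) ∣ ((l * m * n : ℕ) : ℤ) - a then (1 : ℝ) else 0) ≤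
        C * X ^ δ * ((⌊2 * L⌋₊ * Xm * Xn : ℕ) / (d : ℝ) + 1) := by
  classical
  obtain ⟨Cσ, hCσ, hσ⟩ := sigma_zero_sq_le_rpow hδ
  refine ⟨Cσ, hCσ, fun a Xm Xn L X d hL hX hXm hXn hLX => ?_⟩
  have hX0 : 0 < X := by linarith
  set K : ℕ := ⌊2 * L⌋₊ * Xm * Xn with hK
  set f : ℕ → ℝ := fun k => if (d : ℤ) ∣ (k : ℤ) - a then (1 : ℝ) else 0 with hf
  have hf0 : ∀ k, 0 ≤ f k := fun k => by simp only [hf]; split_ifs <;> norm_num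
  have hf1 : ∀ k, f k ≤ 1 := fun k => by simp only [hf]; split_ifs <;> norm_num
  set P : Finset (ℕ × (ℕ × ℕ)) := dyadic L ×ˢ (Icc 1 Xm ×ˢ Icc 1 Xn) with hP
  set pr : ℕ × (ℕ × ℕ) → ℕ := fun p => p.1 * p.2.1 * p.2.2 with hpr
  -- rewrite as a sum over the box, then over the fibres of `π`
  have hbox : ∑ l ∈ dyadic L, ∑ m ∈ Icc 1 Xm, ∑ n ∈ Icc 1 Xn,
      (if (d : ℤ) ∣ ((l * m * n : ℕ) : ℤ) - a then (1 : ℝ) else 0) = ∑ p ∈ P, f (pr p) := by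
    rw [hP, Finset.sum_product]
    refine Finset.sum_congr rfl fun l _ => ?_
    rw [Finset.sum_product]
  rw [hbox, Finset.sum_comp f pr]
  -- the image of `pr` lies in `[1, K]`
  have himage : P.image pr ⊆ Icc 1 K := by
    intro k hk
    rw [Finset.mem_image] at hk
    obtain ⟨p, hp, rfl⟩ := hk
    rw [hP, Finset.mem_product, Finset.mem_product] at hp
    obtain ⟨hl, hm, hn⟩ := hp
    have hl' := dyadic_subset_Icc hL hl
    rw [Finset.mem_Icc] at hl' hm hn ⊢
    refine ⟨?_, ?_⟩
    · simp only [hpr]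
      exact Nat.one_le_iff_ne_zero.2 (Nat.mul_ne_zero (Nat.mul_ne_zero (by omega) (by omega)) (by omega))
    · simp only [hpr, hK]
      exact Nat.mul_le_mul (Nat.mul_le_mul hl'.2 hm.2) hn.2
  -- fibres have at most `τ(k)²` elements
  have hfib : ∀ k ∈ P.image pr, ((P.filter (fun p => pr p = k)).card : ℝ) ≤ Cσ * X ^ δ := by
    intro k hk
    have hk1 := Finset.mem_Icc.1 (himage hk)
    have hk0 : k ≠ 0 := by omega
    have hc := card_triples_le hk0 (dyadic L) (Icc 1 Xm) (Icc 1 Xn)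
    have hkX : (k : ℝ) ≤ 3 * X ^ 3 := by
      have h1 : (k : ℝ) ≤ (K : ℝ) := by exact_mod_cast hk1.2
      have h2 : (K : ℝ) ≤ 2 * L * X * X := by
        rw [hK]; push_cast
        have hfl : (⌊2 * L⌋₊ : ℝ) ≤ 2 * L := Nat.floor_le (by linarith)
        have : (0 : ℝ) ≤ ⌊2 * L⌋₊ := Nat.cast_nonneg _
        gcongr
      have h3 : 2 * L * X * X ≤ 3 * X ^ 3 := by nlinarith [mul_nonneg (mul_nonneg hX0.le hX0.le) hX0.le]
      linarith
    calc ((P.filter (fun p => pr p = k)).card : ℝ) ≤ ((k.divisors.card ^ 2 : ℕ) : ℝ) := by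
          exact_mod_cast hc
      _ = (σ 0 k : ℝ) ^ 2 := by rw [ArithmeticFunction.sigma_zero_apply]; push_cast; ring
      _ ≤ Cσ * X ^ δ := hσ k X hX hkX
  -- the class count
  have hclass : ∑ k ∈ Icc 1 K, f k ≤ (K : ℝ) / d + 1 := by
    have : ∑ k ∈ Icc 1 K, f k = (((Icc 1 K).filter (fun k : ℕ => (k : ZMod d) = (a : ZMod d))).card : ℝ) := by
      rw [Finset.card_eq_sum_ones, Nat.cast_sum, Finset.sum_filter]
      push_cast
      refine Finset.sum_congr rfl fun k _ => ?_
      simp only [hf]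
      have hiff : (d : ℤ) ∣ (k : ℤ) - a ↔ ((k : ℕ) : ZMod d) = (a : ZMod d) := by
        rw [show ((k : ℕ) : ZMod d) = ((k : ℤ) : ZMod d) by rw [Int.cast_natCast],
          ZMod.intCast_eq_intCast_iff_dvd_sub]
        constructor
        · intro h; have := h.neg_right; rwa [neg_sub] at this
        · intro h; have := h.neg_right; rwa [neg_sub] at this
      by_cases h : (d : ℤ) ∣ (k : ℤ) - a
      · rw [if_pos h, if_pos (hiff.1 h)]
      · rw [if_neg h, if_neg (fun h' => h (hiff.2 h'))]
    rw [this]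
    exact card_Icc_filter_natCast_eq_le d K _
  calc ∑ k ∈ P.image pr, (P.filter (fun p => pr p = k)).card • f k
      ≤ ∑ k ∈ P.image pr, Cσ * X ^ δ * f k := by
        refine Finset.sum_le_sum fun k hk => ?_
        rw [nsmul_eq_mul]
        exact mul_le_mul_of_nonneg_right (hfib k hk) (hf0 k)
    _ ≤ ∑ k ∈ Icc 1 K, Cσ * X ^ δ * f k :=
        Finset.sum_le_sum_of_subset_of_nonneg himage fun k _ _ => mul_nonneg (by positivity) (hf0 k)
    _ = Cσ * X ^ δ * ∑ k ∈ Icc 1 K, f k := by rw [Finset.mul_sum]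
    _ ≤ Cσ * X ^ δ * ((K : ℝ) / d + 1) := mul_le_mul_of_nonneg_left hclass (by positivity)
    _ = _ := by rw [hK]


/-- **The trivial bound for a thin weight `γ`**: if `|γ| ≤ 1` is supported on a set `T` of
integers `q ≥ Q₀ > 0`, `|α|, |β| ≤ 1`, and all sizes are `≤ X`, then for every `δ > 0`,
`Δ(α, β, γ) ≤ C_δ X^δ (#T/Q₀ · (2L+1) Xm Xn + #T (2R+1))`: for each modulus `qr` the triples
`(l, m, n)` with `lmn ≡ a (mod qr)` are counted through `k = lmn ≤ 2L Xm Xn` (at most `τ(k)²` triples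
per `k`, at most `2LXmXn/(qr) + 1` values of `k`), and `∑_{q ∈ T} 1/q ≤ #T/Q₀`, `∑_{r∼R} 1/r ≤ 2`;
the expected parts through `1/φ(qr) ≤ τ(q)τ(r)/(qr)`. [cite: BombieriFriedlanderIwaniecActa1986, §14 p. 245] -/
theorem tripleT_le_of_thin_gamma {δ : ℝ} (hδ : 0 < δ) :
    ∃ C : ℝ, 0 < C ∧ ∀ (a : ℤ) (Xm Xn Xq : ℕ) (T : Finset ℕ) (α β γ : ℕ → ℝ) (L R X Q₀ : ℝ),
      0 ≤ L → 0 ≤ R → 1 ≤ X → (Xm : ℝ) ≤ X → (Xn : ℝ) ≤ X → (Xq : ℝ) ≤ X → L ≤ X → R ≤ X →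
      0 < Q₀ → (∀ q ∈ T, Q₀ ≤ (q : ℝ)) →
      (∀ m, |α m| ≤ 1) → (∀ n, |β n| ≤ 1) → (∀ q, |γ q| ≤ 1) → (∀ q, γ q ≠ 0 → q ∈ T) →
      tripleT a Xm Xn Xq α β γ L R ≤
        C * X ^ δ * (T.card / Q₀ * ((2 * L + 1) * Xm * Xn) + T.card * (2 * R + 1)) := by
  obtain ⟨Ct, hCt, ht⟩ := sum_triple_dvd_indicator_le hδ
  obtain ⟨Cσ, hCσ, hσ⟩ := sigma_zero_sq_le_rpow hδ
  refine ⟨2 * Ct + 2 * Cσ, by positivity, ?_⟩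
  intro a Xm Xn Xq T α β γ L R X Q₀ hL hR hX hXm hXn hXq hLX hRX hQ₀ hTQ hα hβ hγ hγT
  have hX0 : 0 < X := by linarith
  refine (tripleT_le_sum_abs_of_thin_gamma a Xm Xn Xq α β hγ hγT L R).trans ?_
  set TQ : Finset ℕ := (Icc 1 Xq).filter (fun q : ℕ => q ∈ T) with hTQdef
  rw [show ∑ r ∈ dyadic R, ∑ l ∈ dyadic L, ∑ q ∈ TQ,
        (|congrW a Xm Xn α β l (q * r)| + |coprW Xm Xn α β (q * r)| / (Nat.totient (q * r) : ℝ)) =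
      (∑ r ∈ dyadic R, ∑ l ∈ dyadic L, ∑ q ∈ TQ, |congrW a Xm Xn α β l (q * r)|) +
        ∑ r ∈ dyadic R, ∑ l ∈ dyadic L, ∑ q ∈ TQ,
          |coprW Xm Xn α β (q * r)| / (Nat.totient (q * r) : ℝ) by
    simp only [Finset.sum_add_distrib]]
  have hTQcard : (TQ.card : ℝ) ≤ T.card := by
    exact_mod_cast Finset.card_le_card
      (fun q (hq : q ∈ (Icc 1 Xq).filter (fun q : ℕ => q ∈ T)) => (Finset.mem_filter.1 hq).2)
  have hdyL : ((dyadic L).card : ℝ) ≤ 2 * L + 1 := by linarith [card_dyadic_le_two_mul hL]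
  have hdyR : ((dyadic R).card : ℝ) ≤ 2 * R + 1 := by linarith [card_dyadic_le_two_mul hR]
  -- the reciprocal sums
  have hinvq : ∑ q ∈ TQ, (1 : ℝ) / q ≤ T.card / Q₀ := by
    calc ∑ q ∈ TQ, (1 : ℝ) / q ≤ ∑ _q ∈ TQ, 1 / Q₀ := by
          refine Finset.sum_le_sum fun q hq => ?_
          exact one_div_le_one_div_of_le hQ₀ (hTQ q (Finset.mem_filter.1 hq).2)
      _ = (TQ.card : ℝ) * (1 / Q₀) := by rw [Finset.sum_const, nsmul_eq_mul]
      _ ≤ T.card * (1 / Q₀) := by gcongr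
      _ = T.card / Q₀ := by ring
  have hinvr : ∑ r ∈ dyadic R, (1 : ℝ) / r ≤ 2 := sum_dyadic_one_div_le_two hR
  have hinvqr : ∑ r ∈ dyadic R, ∑ q ∈ TQ, (1 : ℝ) / ((q : ℝ) * r) ≤ 2 * (T.card / Q₀) := by
    calc ∑ r ∈ dyadic R, ∑ q ∈ TQ, (1 : ℝ) / ((q : ℝ) * r)
        = (∑ r ∈ dyadic R, (1 : ℝ) / r) * ∑ q ∈ TQ, (1 : ℝ) / q := by
          rw [Finset.sum_mul]
          refine Finset.sum_congr rfl fun r _ => ?_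
          rw [Finset.mul_sum]
          refine Finset.sum_congr rfl fun q _ => ?_
          rw [one_div_mul_one_div, mul_comm (r : ℝ)]
      _ ≤ 2 * (T.card / Q₀) :=
          mul_le_mul hinvr hinvq (Finset.sum_nonneg fun q _ => by positivity) (by norm_num)
  -- Step 1: the congruence part
  have hK : ((⌊2 * L⌋₊ * Xm * Xn : ℕ) : ℝ) ≤ (2 * L + 1) * Xm * Xn := by
    push_cast
    have : (⌊2 * L⌋₊ : ℝ) ≤ 2 * L + 1 := (Nat.floor_le (by linarith)).trans (by linarith)
    gcongr
  have hA : ∑ r ∈ dyadic R, ∑ l ∈ dyadic L, ∑ q ∈ TQ, |congrW a Xm Xn α β l (q * r)| ≤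
      Ct * X ^ δ * (2 * (T.card / Q₀) * ((2 * L + 1) * Xm * Xn) + T.card * (2 * R + 1)) := by
    calc ∑ r ∈ dyadic R, ∑ l ∈ dyadic L, ∑ q ∈ TQ, |congrW a Xm Xn α β l (q * r)|
        ≤ ∑ r ∈ dyadic R, ∑ l ∈ dyadic L, ∑ q ∈ TQ, ∑ m ∈ Icc 1 Xm, ∑ n ∈ Icc 1 Xn,
            (if ((q * r : ℕ) : ℤ) ∣ ((l * m * n : ℕ) : ℤ) - a then (1 : ℝ) else 0) :=
          Finset.sum_le_sum fun r _ => Finset.sum_le_sum fun l _ => Finset.sum_le_sum fun q _ =>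
            abs_congrW_le_count hα hβ a Xm Xn l (q * r)
      _ = ∑ r ∈ dyadic R, ∑ q ∈ TQ, ∑ l ∈ dyadic L, ∑ m ∈ Icc 1 Xm, ∑ n ∈ Icc 1 Xn,
            (if ((q * r : ℕ) : ℤ) ∣ ((l * m * n : ℕ) : ℤ) - a then (1 : ℝ) else 0) :=
          Finset.sum_congr rfl fun r _ => Finset.sum_comm
      _ ≤ ∑ r ∈ dyadic R, ∑ q ∈ TQ, Ct * X ^ δ * ((⌊2 * L⌋₊ * Xm * Xn : ℕ) / ((q * r : ℕ) : ℝ) + 1) :=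
          Finset.sum_le_sum fun r _ => Finset.sum_le_sum fun q _ => ht a Xm Xn L X (q * r) hL hX hXm hXn hLX
      _ ≤ ∑ r ∈ dyadic R, ∑ q ∈ TQ,
            Ct * X ^ δ * (((2 * L + 1) * Xm * Xn) * (1 / ((q : ℝ) * r)) + 1) := by
          refine Finset.sum_le_sum fun r hr => Finset.sum_le_sum fun q hq => ?_
          have hr0 : (0 : ℝ) < r := by exact_mod_cast pos_of_mem_dyadic hR hr
          have hq0 : (0 : ℝ) < q := by
            exact_mod_cast (Finset.mem_Icc.1 (Finset.mem_filter.1 hq).1).1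
          refine mul_le_mul_of_nonneg_left ?_ (by positivity)
          have hqr : ((q * r : ℕ) : ℝ) = (q : ℝ) * r := by push_cast; ring
          rw [hqr, div_eq_mul_one_div]
          have h0 : (0 : ℝ) ≤ 1 / ((q : ℝ) * r) := by positivity
          exact add_le_add (mul_le_mul_of_nonneg_right hK h0) le_rfl
      _ = Ct * X ^ δ * (((2 * L + 1) * Xm * Xn) * ∑ r ∈ dyadic R, ∑ q ∈ TQ, (1 / ((q : ℝ) * r)) +
            (dyadic R).card * TQ.card) := by
          simp only [mul_add, mul_one, Finset.sum_add_distrib, Finset.sum_const, nsmul_eq_mul,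
            Finset.mul_sum]
          ring
      _ ≤ Ct * X ^ δ * (((2 * L + 1) * Xm * Xn) * (2 * (T.card / Q₀)) + (2 * R + 1) * T.card) := by
          gcongr
      _ = Ct * X ^ δ * (2 * (T.card / Q₀) * ((2 * L + 1) * Xm * Xn) + T.card * (2 * R + 1)) := by ring
  -- Step 2: the expected part
  have hB : ∑ r ∈ dyadic R, ∑ l ∈ dyadic L, ∑ q ∈ TQ,
      |coprW Xm Xn α β (q * r)| / (Nat.totient (q * r) : ℝ) ≤
      Cσ * X ^ δ * (2 * (T.card / Q₀) * ((2 * L + 1) * Xm * Xn)) := by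
    have hστ : ∀ r ∈ dyadic R, ∀ q ∈ TQ, (σ 0 q : ℝ) * (σ 0 r : ℝ) ≤ Cσ * X ^ δ := by
      intro r hr q hq
      have hr' := (mem_dyadic hR).1 hr
      have hq' := (Finset.mem_Icc.1 (Finset.mem_filter.1 hq).1).2
      have hX3 : X ≤ X ^ 3 := by nlinarith [mul_nonneg hX0.le hX0.le]
      have hqX : (q : ℝ) ≤ 3 * X ^ 3 := by
        have : (q : ℝ) ≤ X := le_trans (by exact_mod_cast hq') hXq
        nlinarith
      have hrX : (r : ℝ) ≤ 3 * X ^ 3 := by nlinarith [hr'.2]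
      have h1 := hσ q X hX hqX
      have h2 := hσ r X hX hrX
      nlinarith [sq_nonneg ((σ 0 q : ℝ) - (σ 0 r : ℝ))]
    calc ∑ r ∈ dyadic R, ∑ l ∈ dyadic L, ∑ q ∈ TQ, |coprW Xm Xn α β (q * r)| / (Nat.totient (q * r) : ℝ)
        ≤ ∑ r ∈ dyadic R, ∑ _l ∈ dyadic L, ∑ q ∈ TQ,
            ((Xm : ℝ) * Xn) * (Cσ * X ^ δ * (1 / ((q : ℝ) * r))) := by
          refine Finset.sum_le_sum fun r hr => Finset.sum_le_sum fun l _ => Finset.sum_le_sum fun q hq => ?_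
          have hr0 : 0 < r := pos_of_mem_dyadic hR hr
          have hq0 : 0 < q := (Finset.mem_Icc.1 (Finset.mem_filter.1 hq).1).1
          rw [div_eq_mul_inv]
          refine mul_le_mul (abs_coprW_le_mul hα hβ Xm Xn (q * r)) ?_ (inv_nonneg.2 (Nat.cast_nonneg _))
            (by positivity)
          calc ((Nat.totient (q * r) : ℝ))⁻¹ ≤ (σ 0 q : ℝ) * (σ 0 r : ℝ) / ((q : ℝ) * r) :=
                inv_totient_mul_le hq0 hr0
            _ = (σ 0 q : ℝ) * (σ 0 r : ℝ) * (1 / ((q : ℝ) * r)) := by rw [← div_eq_mul_one_div]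
            _ ≤ Cσ * X ^ δ * (1 / ((q : ℝ) * r)) :=
                mul_le_mul_of_nonneg_right (hστ r hr q hq) (by positivity)
      _ = ((dyadic L).card : ℝ) * (((Xm : ℝ) * Xn) * (Cσ * X ^ δ) *
            ∑ r ∈ dyadic R, ∑ q ∈ TQ, (1 / ((q : ℝ) * r))) := by
          simp_rw [Finset.mul_sum]
          refine Finset.sum_congr rfl fun r _ => ?_
          rw [Finset.sum_const, nsmul_eq_mul, Finset.mul_sum]
          refine Finset.sum_congr rfl fun q _ => ?_
          ring
      _ ≤ (2 * L + 1) * (((Xm : ℝ) * Xn) * (Cσ * X ^ δ) * (2 * (T.card / Q₀))) := by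
          have : 0 ≤ ∑ r ∈ dyadic R, ∑ q ∈ TQ, (1 / ((q : ℝ) * r)) :=
            Finset.sum_nonneg fun r _ => Finset.sum_nonneg fun q _ => by positivity
          gcongr
      _ = Cσ * X ^ δ * (2 * (T.card / Q₀) * ((2 * L + 1) * Xm * Xn)) := by ring
  set P : ℝ := T.card / Q₀ * ((2 * L + 1) * Xm * Xn) with hP
  set Tt : ℝ := T.card * (2 * R + 1) with hTt
  have hT1 : (0 : ℝ) ≤ Tt := by positivity
  have hXδ : 0 ≤ X ^ δ := Real.rpow_nonneg hX0.le δ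
  calc _ ≤ Ct * X ^ δ * (2 * (T.card / Q₀) * ((2 * L + 1) * Xm * Xn) + T.card * (2 * R + 1)) +
        Cσ * X ^ δ * (2 * (T.card / Q₀) * ((2 * L + 1) * Xm * Xn)) := add_le_add hA hB
    _ = (2 * Ct + 2 * Cσ) * X ^ δ * (P + Tt) - (Ct * X ^ δ * Tt + 2 * Cσ * X ^ δ * Tt) := by
        rw [hP, hTt]; ring
    _ ≤ (2 * Ct + 2 * Cσ) * X ^ δ * (P + Tt) := by
        have : 0 ≤ Ct * X ^ δ * Tt + 2 * Cσ * X ^ δ * Tt := by positivity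
        linarith

/-! ### The smoothing step -/

/-- The smooth weight `α(m) = BFI.bump M Y (m)` on the integers. [cite: BombieriFriedlanderIwaniecActa1986, §12 (A₆') p. 235] -/
def bumpW (M Y : ℝ) (m : ℕ) : ℝ := bump M Y m

/-- Unfolding of `bumpW`. [folklore] -/
theorem bumpW_apply (M Y : ℝ) (m : ℕ) : bumpW M Y m = bump M Y m := rfl

/-- `|α(m)| ≤ 1`. [folklore] -/
theorem abs_bumpW_le_one {M Y : ℝ} (hY : 0 < Y) (hM : 0 ≤ M) (m : ℕ) : |bumpW M Y m| ≤ 1 :=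
  abs_bump_le_one hY hM m

/-- `|α(m) − 1_{m∼M}(m)| ≤ 1` (both lie in `[0, 1]`). [folklore] -/
theorem abs_bumpW_sub_ind_le_one {M Y : ℝ} (hY : 0 < Y) (hM : 0 ≤ M) (m : ℕ) :
    |(bumpW M Y - ind (dyadic M)) m| ≤ 1 := by
  have h := bump_mem_Icc hY hM (m : ℝ)
  simp only [Pi.sub_apply, bumpW, ind]
  rw [abs_le]
  split_ifs <;> constructor <;> linarith [h.1, h.2]

/-- Where `α(m) ≠ 1_{m∼M}(m)` we are in the transition set. [folklore] -/
theorem mem_bumpDiffSupport_of_ne {M Y : ℝ} (hY : 0 < Y) (hYM : Y ≤ M) {m : ℕ}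
    (h : (bumpW M Y - ind (dyadic M)) m ≠ 0) : m ∈ bumpDiffSupport M Y := by
  refine mem_bumpDiffSupport hY hYM (m := m) ?_
  simp only [Pi.sub_apply, bumpW, ind] at h
  intro h'
  exact h (by linarith)

/-- **The smoothing split** (pure algebra): with `α, β, γ` any weights,
`Δ(1_M, 1_N, 1_Q) ≤ Δ(α, β, γ) + Δ(α − 1_M, 1_N, 1_Q) + Δ(α, β − 1_N, 1_Q) + Δ(α, β, γ − 1_Q)`.
[cite: BombieriFriedlanderIwaniecActa1986, §12 (12.1) p. 235; §14 p. 244] -/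
theorem tripleT_indicator_le_split (a : ℤ) (Xm Xn Xq : ℕ) (α β γ : ℕ → ℝ) (SM SN SQ : Finset ℕ)
    (L R : ℝ) :
    tripleT a Xm Xn Xq (ind SM) (ind SN) (ind SQ) L R ≤
      tripleT a Xm Xn Xq α β γ L R + tripleT a Xm Xn Xq (α - ind SM) (ind SN) (ind SQ) L R +
        tripleT a Xm Xn Xq α (β - ind SN) (ind SQ) L R + tripleT a Xm Xn Xq α β (γ - ind SQ) L R := by
  have h1 := tripleT_le_add_sub_alpha a Xm Xn Xq α (ind SM) (ind SN) (ind SQ) L R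
  have h2 := tripleT_le_add_sub_beta a Xm Xn Xq α β (ind SN) (ind SQ) L R
  have h3 := tripleT_le_add_sub_gamma a Xm Xn Xq α β γ (ind SQ) L R
  linarith

/-- **The smoothing step of §14, quantified**: for the dyadic block `m ∼ M`, `n ∼ N`, `q ∼ Q` (inside
the cut-offs `Xm, Xn, Xq ≤ X`), the smooth majorants `α = bump M Y_M`, `β = bump N Y_N`,
`γ = bump Q Y_Q` (`0 < Y_M ≤ M`, `0 < Y_N ≤ N`, `0 < Y_Q ≤ Q/2`, `a ≤ M − Y_M`, `a ≤ N − Y_N`) satisfy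
`Δ(1_M, 1_N, 1_Q) ≤ Δ(α, β, γ) + C_δ X^δ ((2Y_M + 2)(2L + 1) Xn + (2Y_N + 2)(2L + 1) Xm
  + (2Y_Q + 2)(2/Q)(2L + 1) Xm Xn + (2Y_Q + 2)(2R + 1))` — BFI's "Here the error term is admissible
provided `M > x^{2ε}`" ((14.2)–(14.3)), for all three smoothed variables.
[cite: BombieriFriedlanderIwaniecActa1986, §14 (14.2)–(14.3) p. 245; §12 (12.1) p. 236] -/
theorem tripleT_indicator_le_smooth {δ : ℝ} (hδ : 0 < δ) :
    ∃ C : ℝ, 0 < C ∧ ∀ (a : ℤ) (Xm Xn Xq : ℕ) (M N Q YM YN YQ L R X : ℝ),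
      0 < YM → YM ≤ M → 0 < YN → YN ≤ N → 0 < YQ → YQ ≤ Q / 2 →
      0 ≤ L → 0 ≤ R → 1 ≤ X → (Xm : ℝ) ≤ X → (Xn : ℝ) ≤ X → (Xq : ℝ) ≤ X → L ≤ X → R ≤ X →
      |(a : ℝ)| ≤ X → (a : ℝ) ≤ M - YM → (a : ℝ) ≤ N - YN →
      tripleT a Xm Xn Xq (ind (dyadic M)) (ind (dyadic N)) (ind (dyadic Q)) L R ≤
        tripleT a Xm Xn Xq (bumpW M YM) (bumpW N YN) (bumpW Q YQ) L R +
          C * X ^ δ * ((2 * YM + 2) * (2 * L + 1) * Xn + (2 * YN + 2) * (2 * L + 1) * Xm +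
            (2 * YQ + 2) / (Q / 2) * ((2 * L + 1) * Xm * Xn) + (2 * YQ + 2) * (2 * R + 1)) := by
  obtain ⟨C₁, hC₁, h₁⟩ := tripleT_le_of_thin_alpha hδ
  obtain ⟨C₃, hC₃, h₃⟩ := tripleT_le_of_thin_gamma hδ
  refine ⟨max C₁ C₃, lt_max_of_lt_left hC₁, ?_⟩
  intro a Xm Xn Xq M N Q YM YN YQ L R X hYM0 hYM hYN0 hYN hYQ0 hYQ hL hR hX hXm hXn hXq hLX hRX
    haX haM haN
  have hM : 0 ≤ M := hYM0.le.trans hYM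
  have hN : 0 ≤ N := hYN0.le.trans hYN
  have hQ0 : 0 < Q := by linarith
  have hYQ' : YQ ≤ Q := by linarith
  have hX0 : 0 < X := by linarith
  have hXδ : 0 ≤ X ^ δ := Real.rpow_nonneg hX0.le δ
  -- the split
  refine (tripleT_indicator_le_split a Xm Xn Xq (bumpW M YM) (bumpW N YN) (bumpW Q YQ)
    (dyadic M) (dyadic N) (dyadic Q) L R).trans ?_
  -- weights bounded by one
  have hbM : ∀ m, |bumpW M YM m| ≤ 1 := abs_bumpW_le_one hYM0 hM
  have hbN : ∀ n, |bumpW N YN n| ≤ 1 := abs_bumpW_le_one hYN0 hN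
  have hiN : ∀ n, |ind (dyadic N) n| ≤ 1 := abs_ind_le_one _
  have hiQ : ∀ q, |ind (dyadic Q) q| ≤ 1 := abs_ind_le_one _
  -- (i) the `m`-correction
  have hE1 : tripleT a Xm Xn Xq (bumpW M YM - ind (dyadic M)) (ind (dyadic N)) (ind (dyadic Q)) L R ≤
      C₁ * X ^ δ * (bumpDiffSupport M YM).card * (2 * L + 1) * Xn :=
    h₁ a Xm Xn Xq (bumpDiffSupport M YM) _ _ _ L R X hL hR hX hXm hXn hXq hLX hRX haX
      (fun m hm => by
        have h := lt_of_mem_bumpDiffSupport hYM0.le hYM hm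
        have : (a : ℝ) < m := by linarith
        exact_mod_cast this)
      (abs_bumpW_sub_ind_le_one hYM0 hM) (fun m hm => mem_bumpDiffSupport_of_ne hYM0 hYM hm) hiN hiQ
  -- (ii) the `n`-correction, after swapping `m ↔ n`
  have hE2 : tripleT a Xm Xn Xq (bumpW M YM) (bumpW N YN - ind (dyadic N)) (ind (dyadic Q)) L R ≤
      C₁ * X ^ δ * (bumpDiffSupport N YN).card * (2 * L + 1) * Xm := by
    rw [tripleT_swap]
    exact h₁ a Xn Xm Xq (bumpDiffSupport N YN) _ _ _ L R X hL hR hX hXn hXm hXq hLX hRX haX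
      (fun n hn => by
        have h := lt_of_mem_bumpDiffSupport hYN0.le hYN hn
        have : (a : ℝ) < n := by linarith
        exact_mod_cast this)
      (abs_bumpW_sub_ind_le_one hYN0 hN) (fun n hn => mem_bumpDiffSupport_of_ne hYN0 hYN hn) hbM hiQ
  -- (iii) the `q`-correction
  have hE3 : tripleT a Xm Xn Xq (bumpW M YM) (bumpW N YN) (bumpW Q YQ - ind (dyadic Q)) L R ≤
      C₃ * X ^ δ * ((bumpDiffSupport Q YQ).card / (Q / 2) * ((2 * L + 1) * Xm * Xn) +
        (bumpDiffSupport Q YQ).card * (2 * R + 1)) :=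
    h₃ a Xm Xn Xq (bumpDiffSupport Q YQ) _ _ _ L R X (Q / 2) hL hR hX hXm hXn hXq hLX hRX (by positivity)
      (fun q hq => by
        have h := lt_of_mem_bumpDiffSupport hYQ0.le hYQ' hq
        linarith)
      hbM hbN (abs_bumpW_sub_ind_le_one hYQ0 hQ0.le) (fun q hq => mem_bumpDiffSupport_of_ne hYQ0 hYQ' hq)
  -- cardinalities of the transition sets
  have hcM := card_bumpDiffSupport_le hYM0.le hYM
  have hcN := card_bumpDiffSupport_le hYN0.le hYN
  have hcQ := card_bumpDiffSupport_le hYQ0.le hYQ'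
  -- compare constants
  have hC₁' : C₁ ≤ max C₁ C₃ := le_max_left _ _
  have hC₃' : C₃ ≤ max C₁ C₃ := le_max_right _ _
  set C := max C₁ C₃ with hC
  have hF1 : C₁ * X ^ δ * (bumpDiffSupport M YM).card * (2 * L + 1) * Xn ≤
      C * X ^ δ * ((2 * YM + 2) * (2 * L + 1) * Xn) := by
    have : 0 ≤ (2 * L + 1) * (Xn : ℝ) := by positivity
    calc C₁ * X ^ δ * (bumpDiffSupport M YM).card * (2 * L + 1) * Xn
        = C₁ * (X ^ δ * ((bumpDiffSupport M YM).card * ((2 * L + 1) * Xn))) := by ring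
      _ ≤ C * (X ^ δ * ((2 * YM + 2) * ((2 * L + 1) * Xn))) := by gcongr
      _ = _ := by ring
  have hF2 : C₁ * X ^ δ * (bumpDiffSupport N YN).card * (2 * L + 1) * Xm ≤
      C * X ^ δ * ((2 * YN + 2) * (2 * L + 1) * Xm) := by
    have : 0 ≤ (2 * L + 1) * (Xm : ℝ) := by positivity
    calc C₁ * X ^ δ * (bumpDiffSupport N YN).card * (2 * L + 1) * Xm
        = C₁ * (X ^ δ * ((bumpDiffSupport N YN).card * ((2 * L + 1) * Xm))) := by ring
      _ ≤ C * (X ^ δ * ((2 * YN + 2) * ((2 * L + 1) * Xm))) := by gcongr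
      _ = _ := by ring
  have hF3 : C₃ * X ^ δ * ((bumpDiffSupport Q YQ).card / (Q / 2) * ((2 * L + 1) * Xm * Xn) +
        (bumpDiffSupport Q YQ).card * (2 * R + 1)) ≤
      C * X ^ δ * ((2 * YQ + 2) / (Q / 2) * ((2 * L + 1) * Xm * Xn) + (2 * YQ + 2) * (2 * R + 1)) := by
    have : 0 ≤ (2 * L + 1) * (Xm : ℝ) * Xn := by positivity
    gcongr
  linarith [hE1.trans hF1, hE2.trans hF2, hE3.trans hF3]

end BFI

end Literature.NumberTheory.Sieve
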